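import Literature.Probability.RandomPlanarGeometry.YangBaxterSAWObservable
import Literature.Probability.RandomPlanarGeometry.HexSAWHopf
import Mathlib.Analysis.SpecialFunctions.Complex.Arg
import HarnessLib

/-!
# Glazman–Manolescu: the windings of walks to the boundary of the rectangle (a discrete Umlaufsatz)

Topic `Literature/Probability/RandomPlanarGeometry`; fifth support file for the discharge of
`Literature.Probability.RandomPlanarGeometry.SAW.YangBaxter.GlazmanManolescu2019_thm1`. It DISCHARGES
the named fact `GlazmanManolescu2019_boundaryWinding` of `YangBaxterSAWObservable.lean`
(`GlazmanManolescu2019_boundaryWinding_holds`): for a walk of `Rect_{T,L}(Θ)` from the boundary point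
`0`, the winding (total rotation `Σ arcTurn`) is `±π` to another point of the left side, `0` to the
right side ("the winding of any bridge is `0`"), `θ_k` to the top side and `θ_k − π` to the bottom
side ("walks … with endpoint on `δ` and `ε` have winding in `[π/3, 2π/3]` and `[−2π/3, −π/3]`",
A. Glazman, I. Manolescu, arXiv:1708.00395, §2.2; used silently in Lemma 2.2 = [Gl, Lem. 4.1]: "for
the points on the boundary we know the winding"). This is a topological statement (H. Hopf,
*Über die Drehung der Tangenten und Sehnen ebener Kurven*, Compositio Math. 2 (1935)); we prove it by
reduction to the discrete Hopf lemma `Literature.Probability.RandomPlanarGeometry.SAW.Hopf.hopf_open`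
of `HexSAWHopf.lean` (total turning of a polyline all of whose segments are seen from all its other
vertices under an angle `< π/2` = angle swept by the secant into the end + angle swept by the secant
from the start).

## The argument

1. **Reduction to right angles** (`YBWalk.winding_eq_winding_pi_div_two_add`): the rotation of an
   arc in a rhombus of angle `θ` differs from that of the same arc in a square by
   `(θ − π/2)(𝟙[exit side slanted] − 𝟙[entry side slanted])` (`arcTurn_sub_arcTurn_pi_div_two`);
   consecutive arcs at a slanted edge lie in the same column, so these differences telescope to the
   potential `slantPot Θ` of the final edge minus that of the initial one: the winding of a walk from
   a vertical edge is that of the right-angle tiling, plus `θ_k − π/2` if it ends on a slanted edge of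
   column `k`.
2. **An integer polyline** (`YBWalk.vtx`): in the square grid of mesh `4`, a walk is drawn from the
   midpoint `midPt` of its first edge through, for each arc, the two inner points `innerPt` of its
   face one unit inside from the midpoints of its entry and exit sides, to the midpoint of its last
   edge. Its total turning is the right-angle winding (`YBWalk.sum_ext_angles_eq_winding`: the two
   exterior angles at the inner points of an arc add up to its rotation, `ext_angles_eq_arcTurn`,
   the segments across edges being normal to them).
3. **Hopf's hypothesis** (`YBWalk.subtended`): every segment of this polyline is seen from every
   other vertex under an angle `< π/2`, i.e. `sdot > 0`. Far vertices are handled by a norm bound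
   (`sdot_pos_of_far`), near ones by finite tables decided by computation (`sdot_inOff_pos`,
   `sdot_inOff_near_pos`, `sdot_mid_vert_near_pos`, `sdot_mid_slant_near_pos`), crossing and end
   segments by arithmetic (`sdot_cross_eq`, `sdot_half_pos`); the only configurations of the grid
   violating the condition — a straight chord seen from the inner point of a perpendicular arc of the
   same square, and a crossing segment seen from its own midpoint — do not occur in a self-avoiding
   walk (`YBWalk.not_straight_of_two_arcs`: the second arc would be the crossing straight one;
   midpoints are vertices only at the two ends), and the vertices are pairwise distinct
   (`YBWalk.vtx_injective`).
4. **Evaluation** (`hopf_eval`, `YBWalk.winding_pi_div_two_eq`): all vertices have abscissa `≥ 0`,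
   and lie behind the final edge for each of the four boundary classes, so both swept angles are
   differences of arguments; the four values `±π, 0, π/2, −π/2` follow from the arguments of the
   first and last segments and of the chord (`YBWalk.winding_pi_div_two_alpha/beta/delta/eps`).
-/

noncomputable section

open Real Filter Topology
open scoped ENNReal

namespace Literature.Probability.RandomPlanarGeometry.SAW.YangBaxter

open MidEdge

/-! ### The right-angle drawing: integer coordinates -/

/-- Inward unit normal of a side of a square face. [folklore] -/
def Side.nIn : Side → ℤ × ℤ
  | .W => (1, 0)
  | .E => (-1, 0)
  | .S => (0, 1)
  | .N => (0, -1)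

/-- Position of the midpoint of a side relative to the lower-left corner of its face (squares of
side `4`). [folklore] -/
def Side.offset : Side → ℤ × ℤ
  | .W => (0, 2)
  | .E => (4, 2)
  | .S => (2, 0)
  | .N => (2, 4)

/-- Relative position of the inner point near a side: `offset + nIn ∈ {1,2,3}²`. [folklore] -/
def Side.inOff (s : Side) : ℤ × ℤ := s.offset + s.nIn

/-- The opposite side. [folklore] -/
def Side.opp : Side → Side
  | .W => .E
  | .E => .W
  | .S => .N
  | .N => .S

/-- The midpoint of an edge in the right-angle drawing (squares of side `4`). [folklore] -/
def midPt : MidEdge → ℤ × ℤ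
  | .vert k j => (4 * k, 4 * j + 2)
  | .slant k j => (4 * k + 2, 4 * j)

/-- The corner of a face, scaled. [folklore] -/
def Face.base (f : Face) : ℤ × ℤ := (4 * f.1, 4 * f.2)

/-- The midpoint of the side `s` of the face `f`. [folklore] -/
theorem midPt_side (f : Face) (s : Side) : midPt (f.side s) = f.base + s.offset := by
  obtain ⟨k, j⟩ := f
  cases s <;> (simp [midPt, Face.side, Side.offset, Face.base]; try ring)

/-- The inner point of the face `f` near its side `s`: one unit inside along the normal. [folklore] -/
def innerPt (f : Face) (s : Side) : ℤ × ℤ := f.base + s.inOff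

/-- The dot product `(B − w)·(A − w)` deciding whether `w` sees the segment `[A, B]` under an
angle `< π/2`. [folklore] -/
def sdot (A B w : ℤ × ℤ) : ℤ := (B.1 - w.1) * (A.1 - w.1) + (B.2 - w.2) * (A.2 - w.2)

/-- `sdot` is translation invariant. [folklore] -/
theorem sdot_add (A B w c : ℤ × ℤ) : sdot (A + c) (B + c) (w + c) = sdot A B w := by
  unfold sdot; simp only [Prod.fst_add, Prod.snd_add]; ring

/-! #### Local tables (decided by computation) -/

/-- Same face: a chord against the inner point of another arc is seen under an angle `< π/2`,
unless the chord is straight. [folklore] -/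
theorem sdot_inOff_pos : ∀ s t σ : Side, s ≠ t → σ ≠ s → σ ≠ t → t ≠ s.opp →
    0 < sdot s.inOff t.inOff σ.inOff := by decide

/-- Chord against an inner point of a face at `ℓ∞`-distance `1`. [folklore] -/
theorem sdot_inOff_near_pos : ∀ (d₁ d₂ : Fin 3) (s t σ : Side), s ≠ t → (d₁, d₂) ≠ (1, 1) →
    0 < sdot ((4 * ((d₁ : ℤ) - 1), 4 * ((d₂ : ℤ) - 1)) + s.inOff) ((4 * ((d₁ : ℤ) - 1), 4 * ((d₂ : ℤ) - 1)) + t.inOff)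
      σ.inOff := by decide

/-- Chord against a midpoint of an edge at `ℓ∞`-distance `≤ 1` (vertical edges). [folklore] -/
theorem sdot_mid_vert_near_pos : ∀ (d₁ d₂ : Fin 3) (s t : Side), s ≠ t →
    0 < sdot ((4 * ((d₁ : ℤ) - 1), 4 * ((d₂ : ℤ) - 1)) + s.inOff) ((4 * ((d₁ : ℤ) - 1), 4 * ((d₂ : ℤ) - 1)) + t.inOff)
      (0, 2) := by decide

/-- Chord against a midpoint of an edge at `ℓ∞`-distance `≤ 1` (slanted edges). [folklore] -/
theorem sdot_mid_slant_near_pos : ∀ (d₁ d₂ : Fin 3) (s t : Side), s ≠ t →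
    0 < sdot ((4 * ((d₁ : ℤ) - 1), 4 * ((d₂ : ℤ) - 1)) + s.inOff) ((4 * ((d₁ : ℤ) - 1), 4 * ((d₂ : ℤ) - 1)) + t.inOff)
      (2, 0) := by decide

/-! #### Far points -/

/-- Product of two integers `4d + x`, `4d + y` with `|d| ≥ 2` and `x, y ∈ [-3, 3]` is `≥ 25`. [folklore] -/
theorem mul_ge_of_far {d x y : ℤ} (hd : 2 ≤ |d|) (hx : -3 ≤ x ∧ x ≤ 3) (hy : -3 ≤ y ∧ y ≤ 3) :
    25 ≤ (4 * d + x) * (4 * d + y) := by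
  rcases le_abs'.1 hd with h | h
  · nlinarith [mul_nonneg (show (0:ℤ) ≤ -(4 * d + x) - 5 by linarith) (show (0:ℤ) ≤ -(4 * d + y) - 5 by linarith)]
  · nlinarith [mul_nonneg (show (0:ℤ) ≤ (4 * d + x) - 5 by linarith) (show (0:ℤ) ≤ (4 * d + y) - 5 by linarith)]

/-- Product of two integers `4d + x`, `4d + y` with `x, y ∈ [-3, 3]` is `≥ -9`. [folklore] -/
theorem mul_ge_neg_nine {d x y : ℤ} (hx : -3 ≤ x ∧ x ≤ 3) (hy : -3 ≤ y ∧ y ≤ 3) :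
    -9 ≤ (4 * d + x) * (4 * d + y) := by
  rcases lt_trichotomy d 0 with h | rfl | h
  · nlinarith [mul_nonneg (show (0:ℤ) ≤ -(4 * d + x) - 1 by linarith) (show (0:ℤ) ≤ -(4 * d + y) - 1 by linarith)]
  · simp only [mul_zero, zero_add]; nlinarith
  · nlinarith [mul_nonneg (show (0:ℤ) ≤ (4 * d + x) - 1 by linarith) (show (0:ℤ) ≤ (4 * d + y) - 1 by linarith)]

/-- **Far vertices see every chord under an angle `< π/2`**: if the face of the chord and the
face/edge of the vertex are at `ℓ∞`-distance `≥ 2`. [folklore] -/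
theorem sdot_pos_of_far {p w₀ u u' ω : ℤ × ℤ} (hu : 0 ≤ u.1 ∧ u.1 ≤ 3 ∧ 0 ≤ u.2 ∧ u.2 ≤ 3)
    (hu' : 0 ≤ u'.1 ∧ u'.1 ≤ 3 ∧ 0 ≤ u'.2 ∧ u'.2 ≤ 3) (hω : 0 ≤ ω.1 ∧ ω.1 ≤ 3 ∧ 0 ≤ ω.2 ∧ ω.2 ≤ 3)
    (hfar : 2 ≤ |p.1 - w₀.1| ∨ 2 ≤ |p.2 - w₀.2|) :
    0 < sdot ((4 * p.1, 4 * p.2) + u) ((4 * p.1, 4 * p.2) + u') ((4 * w₀.1, 4 * w₀.2) + ω) := by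
  unfold sdot
  simp only [Prod.fst_add, Prod.snd_add]
  have e1 : 4 * p.1 + u'.1 - (4 * w₀.1 + ω.1) = 4 * (p.1 - w₀.1) + (u'.1 - ω.1) := by ring
  have e2 : 4 * p.1 + u.1 - (4 * w₀.1 + ω.1) = 4 * (p.1 - w₀.1) + (u.1 - ω.1) := by ring
  have e3 : 4 * p.2 + u'.2 - (4 * w₀.2 + ω.2) = 4 * (p.2 - w₀.2) + (u'.2 - ω.2) := by ring
  have e4 : 4 * p.2 + u.2 - (4 * w₀.2 + ω.2) = 4 * (p.2 - w₀.2) + (u.2 - ω.2) := by ring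
  rw [e1, e2, e3, e4]
  rcases hfar with h | h
  · have h1 := mul_ge_of_far h (x := u'.1 - ω.1) (y := u.1 - ω.1) (by omega) (by omega)
    have h2 := mul_ge_neg_nine (d := p.2 - w₀.2) (x := u'.2 - ω.2) (y := u.2 - ω.2) (by omega) (by omega)
    linarith
  · have h1 := mul_ge_of_far h (x := u'.2 - ω.2) (y := u.2 - ω.2) (by omega) (by omega)
    have h2 := mul_ge_neg_nine (d := p.1 - w₀.1) (x := u'.1 - ω.1) (y := u.1 - ω.1) (by omega) (by omega)
    linarith

/-- The inner offsets lie in `{1,2,3}²`. [folklore] -/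
theorem Side.inOff_mem (s : Side) : 0 ≤ s.inOff.1 ∧ s.inOff.1 ≤ 3 ∧ 0 ≤ s.inOff.2 ∧ s.inOff.2 ≤ 3 := by
  cases s <;> simp [Side.inOff, Side.offset, Side.nIn]

/-- **A chord is seen from the inner point of any other face under an angle `< π/2`.** [folklore] -/
theorem sdot_innerPt_pos_of_ne {f g : Face} (hfg : f ≠ g) {s t : Side} (hst : s ≠ t) (σ : Side) :
    0 < sdot (innerPt f s) (innerPt f t) (innerPt g σ) := by
  by_cases hfar : 2 ≤ |f.1 - g.1| ∨ 2 ≤ |f.2 - g.2|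
  · exact sdot_pos_of_far s.inOff_mem t.inOff_mem σ.inOff_mem hfar
  · rw [not_or, not_le, not_le, abs_lt, abs_lt] at hfar
    obtain ⟨h1, h2⟩ := hfar
    -- translate `g` to the origin: `d = f - g ∈ {-1,0,1}² \ {0}`
    have key := sdot_inOff_near_pos ⟨(f.1 - g.1 + 1).toNat, by omega⟩ ⟨(f.2 - g.2 + 1).toNat, by omega⟩ s t σ hst
      (by
        intro h
        simp only [Prod.mk.injEq, Fin.ext_iff] at h
        apply hfg; ext <;> omega)
    rw [← sdot_add _ _ _ (-g.base)]
    convert key using 2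
    · simp only [innerPt, Face.base]; ext <;> simp <;> omega
    · simp only [innerPt, Face.base]; ext <;> simp <;> omega
    · simp only [innerPt, Face.base]; ext <;> simp

/-- **A chord is seen from the inner point of another arc of the same face under an angle
`< π/2`**, unless the chord is straight. [folklore] -/
theorem sdot_innerPt_pos_same (f : Face) {s t σ : Side} (hst : s ≠ t) (hσs : σ ≠ s) (hσt : σ ≠ t)
    (hns : t ≠ s.opp) : 0 < sdot (innerPt f s) (innerPt f t) (innerPt f σ) := by
  have key := sdot_inOff_pos s t σ hst hσs hσt hns
  have e : ∀ σ' : Side, innerPt f σ' = σ'.inOff + f.base := fun σ' => by simp [innerPt, add_comm]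
  rw [e, e, e, sdot_add]
  exact key

/-- **A chord is seen from the midpoint of any edge under an angle `< π/2`.** [folklore] -/
theorem sdot_midPt_pos (f : Face) {s t : Side} (hst : s ≠ t) (e : MidEdge) :
    0 < sdot (innerPt f s) (innerPt f t) (midPt e) := by
  -- the edge `e` as `4 w₀ + ω`
  obtain ⟨w₀, ω, he, hω, hnear⟩ : ∃ w₀ ω : ℤ × ℤ, midPt e = (4 * w₀.1, 4 * w₀.2) + ω ∧
      (0 ≤ ω.1 ∧ ω.1 ≤ 3 ∧ 0 ≤ ω.2 ∧ ω.2 ≤ 3) ∧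
      (∀ d₁ d₂ : Fin 3, 0 < sdot ((4 * ((d₁ : ℤ) - 1), 4 * ((d₂ : ℤ) - 1)) + s.inOff)
        ((4 * ((d₁ : ℤ) - 1), 4 * ((d₂ : ℤ) - 1)) + t.inOff) ω) := by
    cases e with
    | vert k j => exact ⟨(k, j), (0, 2), by simp [midPt], by norm_num,
        fun d₁ d₂ => sdot_mid_vert_near_pos d₁ d₂ s t hst⟩
    | slant k j => exact ⟨(k, j), (2, 0), by simp [midPt], by norm_num,
        fun d₁ d₂ => sdot_mid_slant_near_pos d₁ d₂ s t hst⟩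
  rw [he]
  by_cases hfar : 2 ≤ |f.1 - w₀.1| ∨ 2 ≤ |f.2 - w₀.2|
  · exact sdot_pos_of_far s.inOff_mem t.inOff_mem hω hfar
  · rw [not_or, not_le, not_le, abs_lt, abs_lt] at hfar
    obtain ⟨h1, h2⟩ := hfar
    have key := hnear ⟨(f.1 - w₀.1 + 1).toNat, by omega⟩ ⟨(f.2 - w₀.2 + 1).toNat, by omega⟩
    rw [← sdot_add _ _ _ (-((4 * w₀.1, 4 * w₀.2) : ℤ × ℤ))]
    convert key using 2
    · simp only [innerPt, Face.base]; ext <;> simp <;> omega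
    · simp only [innerPt, Face.base]; ext <;> simp <;> omega
    · ext <;> simp

/-- **A crossing segment** `[m − ν, m + ν]` (`|ν| = 1`) is seen from `w` under an angle `< π/2`
iff `|w − m|² > 1`. [folklore] -/
theorem sdot_cross_eq (m ν w : ℤ × ℤ) :
    sdot (m - ν) (m + ν) w = (m.1 - w.1) ^ 2 + (m.2 - w.2) ^ 2 - (ν.1 ^ 2 + ν.2 ^ 2) := by
  unfold sdot; simp only [Prod.fst_add, Prod.snd_add, Prod.fst_sub, Prod.snd_sub]; ring

/-- `sdot` is symmetric in the segment. [folklore] -/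
theorem sdot_comm (A B w : ℤ × ℤ) : sdot A B w = sdot B A w := by unfold sdot; ring

/-- A product of consecutive integers is `≥ 0`, and `> 0` off `{-1, 0}`. [folklore] -/
theorem consecutive_mul_nonneg (x : ℤ) : 0 ≤ (x + 1) * x := by
  rcases le_or_gt 0 x with h | h
  · positivity
  · have : x + 1 ≤ 0 := by omega
    nlinarith

/-- A product of consecutive integers is `> 0` off `{-1, 0}`. [folklore] -/
theorem consecutive_mul_pos {x : ℤ} (h0 : x ≠ 0) (h1 : x ≠ -1) : 0 < (x + 1) * x := by
  rcases lt_trichotomy x 0 with h | h | h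
  · have : x + 1 < 0 := by omega
    nlinarith
  · exact absurd h h0
  · positivity

/-- **A half segment** `[m, m + ν]` (`ν` a unit normal) is seen from an integer point
`w ∉ {m, m + ν}` under an angle `< π/2`. [folklore] -/
theorem sdot_half_pos (s : Side) {m w : ℤ × ℤ} (h0 : w ≠ m) (h1 : w ≠ m + s.nIn) :
    0 < sdot m (m + s.nIn) w := by
  have hu0 : ¬(w.1 = m.1 ∧ w.2 = m.2) := fun h => h0 (Prod.ext h.1 h.2)
  have hu1 : ¬(w.1 = (m + s.nIn).1 ∧ w.2 = (m + s.nIn).2) := fun h => h1 (Prod.ext h.1 h.2)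
  unfold sdot
  cases s <;> simp only [Side.nIn, Prod.fst_add, Prod.snd_add, add_zero] at hu1 ⊢
  · -- W: ν = (1, 0): (x + 1) x + y²  with x = m.1 - w.1
    by_cases hy : m.2 - w.2 = 0
    · have hx := consecutive_mul_pos (x := m.1 - w.1) (by omega) (by omega)
      nlinarith
    · have hx := consecutive_mul_nonneg (m.1 - w.1)
      have : 0 < (m.2 - w.2) * (m.2 - w.2) := mul_self_pos.2 hy
      nlinarith
  · -- E: ν = (-1, 0): (x - 1) x + y² = ((x-1) + 1)(x - 1) + y²
    by_cases hy : m.2 - w.2 = 0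
    · have hx := consecutive_mul_pos (x := m.1 - w.1 - 1) (by omega) (by omega)
      nlinarith
    · have hx := consecutive_mul_nonneg (m.1 - w.1 - 1)
      have : 0 < (m.2 - w.2) * (m.2 - w.2) := mul_self_pos.2 hy
      nlinarith
  · -- S: ν = (0, 1)
    by_cases hx : m.1 - w.1 = 0
    · have hy := consecutive_mul_pos (x := m.2 - w.2) (by omega) (by omega)
      nlinarith
    · have hy := consecutive_mul_nonneg (m.2 - w.2)
      have : 0 < (m.1 - w.1) * (m.1 - w.1) := mul_self_pos.2 hx
      nlinarith
  · -- N: ν = (0, -1)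
    by_cases hx : m.1 - w.1 = 0
    · have hy := consecutive_mul_pos (x := m.2 - w.2 - 1) (by omega) (by omega)
      nlinarith
    · have hy := consecutive_mul_nonneg (m.2 - w.2 - 1)
      have : 0 < (m.1 - w.1) * (m.1 - w.1) := mul_self_pos.2 hx
      nlinarith

/-! ### The face and sides of an arc, as total functions -/

/-- The face of an arc (junk `(0,0)` if none). [folklore] -/
def faceOf (p : MidEdge × MidEdge) : Face := (arcFace p).getD (0, 0)

/-- The side through which the arc enters its face (junk `W`). [folklore] -/
def sideIn (p : MidEdge × MidEdge) : Side := ((faceOf p).sideOf p.1).getD .W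

/-- The side through which the arc leaves its face (junk `W`). [folklore] -/
def sideOut (p : MidEdge × MidEdge) : Side := ((faceOf p).sideOf p.2).getD .W

/-- The face function on an arc with a face. [folklore] -/
theorem faceOf_eq {p : MidEdge × MidEdge} {f : Face} (h : arcFace p = some f) : faceOf p = f := by
  simp [faceOf, h]

/-- The side functions recover the ends of an arc. [folklore] -/
theorem side_sideIn {p : MidEdge × MidEdge} {f : Face} (h : arcFace p = some f) :
    f.side (sideIn p) = p.1 ∧ f.side (sideOut p) = p.2 ∧ sideIn p ≠ sideOut p := by
  obtain ⟨s, t, hst, hs, ht, -⟩ := exists_sides_of_arcFace h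
  have h1 : sideIn p = s := by rw [sideIn, faceOf_eq h, ← hs, Face.sideOf_side]; rfl
  have h2 : sideOut p = t := by rw [sideOut, faceOf_eq h, ← ht, Face.sideOf_side]; rfl
  rw [h1, h2]; exact ⟨hs, ht, hst⟩

/-! ### Injectivity of the drawing -/

/-- Inner points determine their face and side. [folklore] -/
theorem innerPt_inj {f g : Face} {s t : Side} (h : innerPt f s = innerPt g t) : f = g ∧ s = t := by
  have hs := s.inOff_mem; have ht := t.inOff_mem
  simp only [innerPt, Face.base, Prod.ext_iff, Prod.fst_add, Prod.snd_add] at h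
  have hs1 : 1 ≤ s.inOff.1 ∧ 1 ≤ s.inOff.2 := by cases s <;> simp [Side.inOff, Side.offset, Side.nIn]
  have ht1 : 1 ≤ t.inOff.1 ∧ 1 ≤ t.inOff.2 := by cases t <;> simp [Side.inOff, Side.offset, Side.nIn]
  have h1 : f.1 = g.1 := by omega
  have h2 : f.2 = g.2 := by omega
  refine ⟨Prod.ext h1 h2, ?_⟩
  have e1 : s.inOff.1 = t.inOff.1 := by omega
  have e2 : s.inOff.2 = t.inOff.2 := by omega
  revert e1 e2
  cases s <;> cases t <;> simp [Side.inOff, Side.offset, Side.nIn]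

/-- Midpoints are never inner points. [folklore] -/
theorem midPt_ne_innerPt (e : MidEdge) (g : Face) (σ : Side) : midPt e ≠ innerPt g σ := by
  intro h
  simp only [innerPt, Face.base, Prod.ext_iff, Prod.fst_add, Prod.snd_add] at h
  cases e <;> cases σ <;> simp [midPt, Side.inOff, Side.offset, Side.nIn] at h <;> omega

/-- `midPt` is injective. [folklore] -/
theorem midPt_injective : Function.Injective midPt := by
  intro e e' h
  cases e <;> cases e' <;> simp only [midPt, Prod.mk.injEq, MidEdge.vert.injEq, MidEdge.slant.injEq, reduceCtorEq] at h ⊢ <;> omega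

/-- An inner point at distance `1` from a midpoint is the inner point next to that edge.
[folklore] -/
theorem side_eq_of_dist_one {e : MidEdge} {g : Face} {σ : Side}
    (h : (midPt e - innerPt g σ).1 ^ 2 + (midPt e - innerPt g σ).2 ^ 2 = 1) : g.side σ = e := by
  have hsq : ∀ x y : ℤ, x ^ 2 + y ^ 2 = 1 → (x = 0 ∨ x = 1 ∨ x = -1) ∧ (y = 0 ∨ y = 1 ∨ y = -1) := by
    intro x y hxy
    have hx : x ^ 2 ≤ 1 := by nlinarith
    have hy : y ^ 2 ≤ 1 := by nlinarith
    constructor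
    · rcases lt_trichotomy x 0 with h | h | h
      · right; right; nlinarith
      · left; exact h
      · right; left; nlinarith
    · rcases lt_trichotomy y 0 with h | h | h
      · right; right; nlinarith
      · left; exact h
      · right; left; nlinarith
  obtain ⟨hx, hy⟩ := hsq _ _ h
  simp only [innerPt, Face.base, Prod.fst_sub, Prod.snd_sub, Prod.fst_add, Prod.snd_add] at hx hy
  obtain ⟨k, j⟩ := g
  cases e <;> cases σ <;>
    simp only [midPt, Side.inOff, Side.offset, Side.nIn, Face.side, MidEdge.vert.injEq, MidEdge.slant.injEq,
      reduceCtorEq, Prod.fst_add, Prod.snd_add] at hx hy ⊢ <;> omega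

/-- Two distinct midpoints are at distance `> 1`. [folklore] -/
theorem one_lt_dist_midPt {e e' : MidEdge} (h : e ≠ e') :
    1 < (midPt e - midPt e').1 ^ 2 + (midPt e - midPt e').2 ^ 2 := by
  by_contra hle
  push Not at hle
  have hsq : ∀ x y : ℤ, x ^ 2 + y ^ 2 ≤ 1 → (x = 0 ∨ x = 1 ∨ x = -1) ∧ (y = 0 ∨ y = 1 ∨ y = -1) := by
    intro x y hxy
    have hx : x ^ 2 ≤ 1 := by nlinarith
    have hy : y ^ 2 ≤ 1 := by nlinarith
    constructor
    · rcases lt_trichotomy x 0 with h | h | h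
      · right; right; nlinarith
      · left; exact h
      · right; left; nlinarith
    · rcases lt_trichotomy y 0 with h | h | h
      · right; right; nlinarith
      · left; exact h
      · right; left; nlinarith
  obtain ⟨hx, hy⟩ := hsq _ _ hle
  simp only [Prod.fst_sub, Prod.snd_sub] at hx hy
  apply h
  cases e <;> cases e' <;>
    simp only [midPt, MidEdge.vert.injEq, MidEdge.slant.injEq, reduceCtorEq] at hx hy ⊢ <;> omega

/-- The inner point next to an edge, from the other face, is the mirror image: the two inner
normals of an edge are opposite. [folklore] -/
theorem nIn_eq_neg_of_side_eq {f g : Face} {s t : Side} (h : f.side t = g.side s) (hfg : f ≠ g) :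
    s.nIn = -t.nIn := by
  obtain ⟨k, j⟩ := f; obtain ⟨k', j'⟩ := g
  cases s <;> cases t <;>
    simp only [Face.side, MidEdge.vert.injEq, MidEdge.slant.injEq, reduceCtorEq, Side.nIn, Prod.neg_mk,
      neg_neg, neg_zero, Prod.mk.injEq, ne_eq] at h hfg ⊢ <;> omega

/-! ### The polyline of a walk in the right-angle drawing -/

/-- `getD` inside the range is `getElem`. [folklore] -/
theorem List.getD_eq_getElem' {α : Type*} {l : List α} {i : ℕ} (h : i < l.length) (d : α) :
    l.getD i d = l[i] := by
  rw [List.getD_eq_getElem?_getD, List.getElem?_eq_getElem h, Option.getD_some]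

namespace YBWalk

variable {D : Set Face} {a z : MidEdge} (γ : YBWalk D a z)

/-- The `i`-th arc (junk beyond the end). [folklore] -/
def arcAt (i : ℕ) : MidEdge × MidEdge := γ.arcs.getD i (a, a)

/-- The face of the `i`-th arc. [folklore] -/
def fc (i : ℕ) : Face := faceOf (γ.arcAt i)

/-- The entry side of the `i`-th arc. [folklore] -/
def sIn (i : ℕ) : Side := sideIn (γ.arcAt i)

/-- The exit side of the `i`-th arc. [folklore] -/
def sOut (i : ℕ) : Side := sideOut (γ.arcAt i)

/-- The inner point at which the drawing of the `i`-th arc starts. [folklore] -/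
def ptIn (i : ℕ) : ℤ × ℤ := innerPt (γ.fc i) (γ.sIn i)

/-- The inner point at which the drawing of the `i`-th arc ends. [folklore] -/
def ptOut (i : ℕ) : ℤ × ℤ := innerPt (γ.fc i) (γ.sOut i)

/-- **The polyline of a walk**: the midpoint of the starting edge, then for each arc the inner
points of its face next to its entry and exit sides, then the midpoint of the final edge
(`2n + 2` vertices for `n` arcs; junk `midPt z` beyond). [folklore] -/
def vtx (j : ℕ) : ℤ × ℤ :=
  if j = 0 then midPt a
  else if j ≤ 2 * γ.arcs.length then (if j % 2 = 1 then γ.ptIn ((j - 1) / 2) else γ.ptOut ((j - 1) / 2))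
  else midPt z

variable {γ}

/-- Index bound. [folklore] -/
theorem lt_length_of_lt_arcs {i : ℕ} (hi : i < γ.arcs.length) : i + 1 < γ.mids.length := by
  have := γ.length_arcs; omega

/-- The `i`-th arc joins the `i`-th and `(i+1)`-st mid-edges. [folklore] -/
theorem arcAt_eq {i : ℕ} (hi : i < γ.arcs.length) :
    γ.arcAt i = (γ.mids[i]'(by have := γ.length_arcs; omega), γ.mids[i + 1]'(lt_length_of_lt_arcs hi)) := by
  rw [arcAt, List.getD_eq_getElem' hi, γ.getElem_arcs hi]

/-- The `i`-th arc is an arc. [folklore] -/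
theorem arcAt_mem {i : ℕ} (hi : i < γ.arcs.length) : γ.arcAt i ∈ γ.arcs := by
  rw [arcAt, List.getD_eq_getElem' hi]; exact List.getElem_mem _

/-- The `i`-th arc is drawn in the face `fc i` of the domain. [folklore] -/
theorem arcFace_arcAt {i : ℕ} (hi : i < γ.arcs.length) : arcFace (γ.arcAt i) = some (γ.fc i) ∧ γ.fc i ∈ D := by
  obtain ⟨f, hfD, hf⟩ := γ.arc_mem _ (arcAt_mem hi)
  rw [fc, faceOf_eq hf]; exact ⟨hf, hfD⟩

/-- The entry and exit sides of the `i`-th arc. [folklore] -/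
theorem side_sIn {i : ℕ} (hi : i < γ.arcs.length) :
    (γ.fc i).side (γ.sIn i) = γ.mids[i]'(by have := γ.length_arcs; omega) ∧
      (γ.fc i).side (γ.sOut i) = γ.mids[i + 1]'(lt_length_of_lt_arcs hi) ∧ γ.sIn i ≠ γ.sOut i := by
  have h := side_sideIn (arcFace_arcAt hi).1
  simp only [sIn, sOut, arcAt_eq hi] at h ⊢
  exact h

/-- The polyline starts at the midpoint of the first edge. [folklore] -/
theorem vtx_zero : γ.vtx 0 = midPt a := by simp [vtx]

/-- Odd vertices are entry inner points. [folklore] -/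
theorem vtx_odd {i : ℕ} (hi : i < γ.arcs.length) : γ.vtx (2 * i + 1) = γ.ptIn i := by
  unfold vtx
  rw [if_neg (by omega), if_pos (by omega), if_pos (by omega)]
  congr 1; omega

/-- Even vertices are exit inner points. [folklore] -/
theorem vtx_even {i : ℕ} (hi : i < γ.arcs.length) : γ.vtx (2 * i + 2) = γ.ptOut i := by
  unfold vtx
  rw [if_neg (by omega), if_pos (by omega), if_neg (by omega)]
  congr 1; omega

/-- The polyline ends at the midpoint of the last edge. [folklore] -/
theorem vtx_last : γ.vtx (2 * γ.arcs.length + 1) = midPt z := by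
  unfold vtx
  rw [if_neg (by omega), if_neg (by omega)]

/-- The four kinds of indices of the polyline. [folklore] -/
theorem index_cases (j : ℕ) (hj : j ≤ 2 * γ.arcs.length + 1) :
    j = 0 ∨ (∃ i, i < γ.arcs.length ∧ j = 2 * i + 1) ∨ (∃ i, i < γ.arcs.length ∧ j = 2 * i + 2) ∨
      j = 2 * γ.arcs.length + 1 := by
  rcases Nat.even_or_odd j with ⟨r, hr⟩ | ⟨r, hr⟩
  · rcases Nat.eq_zero_or_pos r with h | h
    · left; omega
    · right; right; left; exact ⟨r - 1, by omega, by omega⟩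
  · by_cases h : r < γ.arcs.length
    · right; left; exact ⟨r, h, by omega⟩
    · right; right; right; omega

/-! #### Distinctness of the vertices -/

/-- Entry inner points are distinct. [folklore] -/
theorem ptIn_inj {i j : ℕ} (hi : i < γ.arcs.length) (hj : j < γ.arcs.length) (h : γ.ptIn i = γ.ptIn j) :
    i = j := by
  obtain ⟨hf, hs⟩ := innerPt_inj h
  have e := (side_sIn hi).1
  rw [hf, hs] at e
  have := ((side_sIn hj).1).symm.trans e
  exact ((γ.nodup.getElem_inj_iff).1 this).symm

/-- Exit inner points are distinct. [folklore] -/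
theorem ptOut_inj {i j : ℕ} (hi : i < γ.arcs.length) (hj : j < γ.arcs.length) (h : γ.ptOut i = γ.ptOut j) :
    i = j := by
  obtain ⟨hf, hs⟩ := innerPt_inj h
  have e := (side_sIn hi).2.1
  rw [hf, hs] at e
  have := ((side_sIn hj).2.1).symm.trans e
  have := (γ.nodup.getElem_inj_iff).1 this
  omega

/-- Entry and exit inner points are distinct (consecutive arcs lie in different faces). [folklore] -/
theorem ptIn_ne_ptOut {i j : ℕ} (hi : i < γ.arcs.length) (hj : j < γ.arcs.length) : γ.ptIn i ≠ γ.ptOut j := by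
  intro h
  obtain ⟨hf, hs⟩ := innerPt_inj h
  have e := (side_sIn hi).1
  rw [hf, hs] at e
  have e' := ((side_sIn hj).2.1).symm.trans e
  have hij : j + 1 = i := ((γ.nodup.getElem_inj_iff).1 e')
  subst hij
  -- consecutive arcs `j`, `j + 1` in the same face
  have h1 := (arcFace_arcAt hi).1
  have h2 := (arcFace_arcAt hj).1
  rw [arcAt_eq hi] at h1
  rw [arcAt_eq hj] at h2
  have := γ.arcFace_ne_succ (i := j) (by have := γ.length_arcs; omega)
  rw [h2, h1, hf] at this
  exact this rfl

/-- A walk with an arc joins distinct edges. [folklore] -/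
theorem a_ne_z (hn : 0 < γ.arcs.length) : a ≠ z := by
  intro e
  have h0 := γ.getElem_zero
  have hl := γ.getElem_length_sub_one
  have := (γ.nodup.getElem_inj_iff).1 (h0.trans (e.trans hl.symm))
  have := γ.length_arcs
  omega

/-- **The vertices of the polyline are pairwise distinct.** [folklore] -/
theorem vtx_injective {j j' : ℕ} (hj : j ≤ 2 * γ.arcs.length + 1) (hj' : j' ≤ 2 * γ.arcs.length + 1)
    (hn : 0 < γ.arcs.length) (h : γ.vtx j = γ.vtx j') : j = j' := by
  have haz := a_ne_z hn
  rcases index_cases j hj with rfl | ⟨i, hi, rfl⟩ | ⟨i, hi, rfl⟩ | rfl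
  · rcases index_cases j' hj' with rfl | ⟨i', hi', rfl⟩ | ⟨i', hi', rfl⟩ | rfl
    · rfl
    · rw [vtx_zero, vtx_odd hi'] at h; exact absurd h (midPt_ne_innerPt _ _ _)
    · rw [vtx_zero, vtx_even hi'] at h; exact absurd h (midPt_ne_innerPt _ _ _)
    · rw [vtx_zero, vtx_last] at h; exact absurd (midPt_injective h) haz
  · rcases index_cases j' hj' with rfl | ⟨i', hi', rfl⟩ | ⟨i', hi', rfl⟩ | rfl
    · rw [vtx_odd hi, vtx_zero] at h; exact absurd h.symm (midPt_ne_innerPt _ _ _)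
    · rw [vtx_odd hi, vtx_odd hi'] at h; have := ptIn_inj hi hi' h; omega
    · rw [vtx_odd hi, vtx_even hi'] at h; exact absurd h (ptIn_ne_ptOut hi hi')
    · rw [vtx_odd hi, vtx_last] at h; exact absurd h.symm (midPt_ne_innerPt _ _ _)
  · rcases index_cases j' hj' with rfl | ⟨i', hi', rfl⟩ | ⟨i', hi', rfl⟩ | rfl
    · rw [vtx_even hi, vtx_zero] at h; exact absurd h.symm (midPt_ne_innerPt _ _ _)
    · rw [vtx_even hi, vtx_odd hi'] at h; exact absurd h.symm (ptIn_ne_ptOut hi' hi)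
    · rw [vtx_even hi, vtx_even hi'] at h; have := ptOut_inj hi hi' h; omega
    · rw [vtx_even hi, vtx_last] at h; exact absurd h.symm (midPt_ne_innerPt _ _ _)
  · rcases index_cases j' hj' with rfl | ⟨i', hi', rfl⟩ | ⟨i', hi', rfl⟩ | rfl
    · rw [vtx_last, vtx_zero] at h; exact absurd (midPt_injective h).symm haz
    · rw [vtx_last, vtx_odd hi'] at h; exact absurd h (midPt_ne_innerPt _ _ _)
    · rw [vtx_last, vtx_even hi'] at h; exact absurd h (midPt_ne_innerPt _ _ _)
    · rfl

end YBWalk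

/-- Inner points sit one unit inside from the midpoint of their side. [folklore] -/
theorem innerPt_eq (f : Face) (s : Side) : innerPt f s = midPt (f.side s) + s.nIn := by
  rw [innerPt, midPt_side, Side.inOff, add_assoc]

/-- The squared norm of a unit normal. [folklore] -/
theorem Side.nIn_sq (s : Side) : s.nIn.1 ^ 2 + s.nIn.2 ^ 2 = 1 := by cases s <;> simp [Side.nIn]

namespace YBWalk

variable {D : Set Face} {a z : MidEdge} {γ : YBWalk D a z}

/-- Consecutive arcs lie in different faces. [folklore] -/
theorem fc_succ_ne {i : ℕ} (hi : i + 1 < γ.arcs.length) : γ.fc i ≠ γ.fc (i + 1) := by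
  intro h
  have h1 := (arcFace_arcAt (show i < γ.arcs.length by omega)).1
  have h2 := (arcFace_arcAt hi).1
  rw [arcAt_eq (show i < γ.arcs.length by omega)] at h1
  rw [arcAt_eq hi] at h2
  have := γ.arcFace_ne_succ (i := i) (by have := γ.length_arcs; omega)
  rw [h1, h2, h] at this
  exact this rfl

/-- **No two straight arcs in a face**: if a face carries two distinct arcs of the walk, neither is
straight (the other would have to be the crossing straight arc). [folklore] -/
theorem not_straight_of_two_arcs {i i' : ℕ} (hi : i < γ.arcs.length) (hi' : i' < γ.arcs.length)
    (hii' : i ≠ i') (hf : γ.fc i' = γ.fc i) : γ.sOut i ≠ (γ.sIn i).opp ∧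
      γ.sIn i' ≠ γ.sIn i ∧ γ.sIn i' ≠ γ.sOut i ∧ γ.sOut i' ≠ γ.sIn i ∧ γ.sOut i' ≠ γ.sOut i := by
  obtain ⟨hs, ht, hst⟩ := side_sIn hi
  obtain ⟨hs', ht', hst'⟩ := side_sIn hi'
  rw [hf] at hs' ht'
  have hinj := fun {x y : ℕ} {hx : x < γ.mids.length} {hy : y < γ.mids.length}
    (h : γ.mids[x] = γ.mids[y]) => (γ.nodup.getElem_inj_iff).1 h
  -- the four sides are pairwise distinct (distinct mid-edges; `i, i'` not consecutive)
  have hcons : i' ≠ i + 1 ∧ i ≠ i' + 1 := by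
    constructor
    · rintro rfl; exact fc_succ_ne hi' hf.symm
    · rintro rfl; exact fc_succ_ne hi hf
  have d1 : γ.sIn i' ≠ γ.sIn i := fun h => by
    have := hinj (hs'.symm.trans (h ▸ hs)); omega
  have d2 : γ.sIn i' ≠ γ.sOut i := fun h => by
    have := hinj (hs'.symm.trans (h ▸ ht)); omega
  have d3 : γ.sOut i' ≠ γ.sIn i := fun h => by
    have := hinj (ht'.symm.trans (h ▸ hs)); omega
  have d4 : γ.sOut i' ≠ γ.sOut i := fun h => by
    have := hinj (ht'.symm.trans (h ▸ ht)); omega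
  refine ⟨fun hopp => ?_, d1, d2, d3, d4⟩
  -- both arcs would be the two crossing straight arcs of `fc i`
  have hp : (γ.mids[i]'(by have := γ.length_arcs; omega), γ.mids[i + 1]'(lt_length_of_lt_arcs hi)) ∈ γ.arcs :=
    γ.mk_mem_arcs _
  have hq : (γ.mids[i']'(by have := γ.length_arcs; omega), γ.mids[i' + 1]'(lt_length_of_lt_arcs hi')) ∈ γ.arcs :=
    γ.mk_mem_arcs _
  rw [← hs, ← ht, hopp] at hp
  rw [← hs', ← ht'] at hq
  have key := γ.noncross (γ.fc i)
  revert hp hq d1 d2 d3 d4 hst' key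
  rw [hopp]
  generalize γ.sIn i = s
  generalize γ.sIn i' = s'
  generalize γ.sOut i' = t'
  intro hst' key d4 d3 d2 d1 hq hp
  cases s <;> cases s' <;> cases t' <;> simp only [Side.opp, ne_eq, not_true_eq_false, reduceCtorEq,
    not_false_eq_true] at d1 d2 d3 d4 hst' <;> tauto

/-- **The polyline of a self-avoiding walk satisfies the hypothesis of Hopf's lemma**: every segment
is seen from every other vertex under an angle `< π/2`. [folklore] -/
theorem subtended {k j : ℕ} (hk : k ≤ 2 * γ.arcs.length) (hj : j ≤ 2 * γ.arcs.length + 1)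
    (h1 : j ≠ k) (h2 : j ≠ k + 1) (hn : 0 < γ.arcs.length) :
    0 < sdot (γ.vtx k) (γ.vtx (k + 1)) (γ.vtx j) := by
  have hvj : ∀ {k'}, k' ≤ 2 * γ.arcs.length + 1 → j ≠ k' → γ.vtx j ≠ γ.vtx k' :=
    fun hk' hne h => hne (vtx_injective hj hk' hn h)
  rcases index_cases (γ := γ) k (by omega) with rfl | ⟨i, hi, rfl⟩ | ⟨i, hi, rfl⟩ | h
  · -- initial half segment
    have e1 : γ.vtx (0 + 1) = midPt a + (γ.sIn 0).nIn := by
      rw [zero_add, show (1 : ℕ) = 2 * 0 + 1 from rfl, vtx_odd hn, ptIn, innerPt_eq, (side_sIn hn).1, γ.getElem_zero]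
    rw [vtx_zero, e1]
    refine sdot_half_pos _ ?_ ?_
    · rw [← vtx_zero (γ := γ)]; exact hvj (by omega) h1
    · rw [← e1]; exact hvj (by omega) h2
  · -- chord of the arc `i`
    rw [vtx_odd hi, show 2 * i + 1 + 1 = 2 * i + 2 by ring, vtx_even hi, ptIn, ptOut]
    have hst := (side_sIn hi).2.2
    rcases index_cases (γ := γ) j hj with rfl | ⟨i', hi', rfl⟩ | ⟨i', hi', rfl⟩ | rfl
    · rw [vtx_zero]; exact sdot_midPt_pos _ hst _
    · rw [vtx_odd hi', ptIn]
      by_cases hf : γ.fc i' = γ.fc i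
      · rw [hf]
        have hii' : i ≠ i' := by rintro rfl; exact h1 rfl
        obtain ⟨hopp, d1, d2, -, -⟩ := not_straight_of_two_arcs hi hi' hii' hf
        exact sdot_innerPt_pos_same _ hst d1 d2 hopp
      · exact sdot_innerPt_pos_of_ne (Ne.symm hf) hst _
    · rw [vtx_even hi', ptOut]
      by_cases hf : γ.fc i' = γ.fc i
      · rw [hf]
        have hii' : i ≠ i' := by rintro rfl; exact h2 rfl
        obtain ⟨hopp, -, -, d3, d4⟩ := not_straight_of_two_arcs hi hi' hii' hf
        exact sdot_innerPt_pos_same _ hst d3 d4 hopp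
      · exact sdot_innerPt_pos_of_ne (Ne.symm hf) hst _
    · rw [vtx_last]; exact sdot_midPt_pos _ hst _
  · rcases Nat.lt_or_ge (i + 1) γ.arcs.length with hi1 | hi1
    · -- crossing segment at the mid-edge `mids[i+1]`
      set m := midPt (γ.mids[i + 1]'(lt_length_of_lt_arcs hi)) with hm
      have eν : (γ.sIn (i + 1)).nIn = -(γ.sOut i).nIn :=
        nIn_eq_neg_of_side_eq (((side_sIn hi).2.1).trans ((side_sIn hi1).1).symm) (fc_succ_ne hi1)
      have ek : γ.vtx (2 * i + 2) = m - (γ.sIn (i + 1)).nIn := by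
        rw [vtx_even hi, ptOut, innerPt_eq, (side_sIn hi).2.1, eν, sub_neg_eq_add]
      have ek1 : γ.vtx (2 * i + 2 + 1) = m + (γ.sIn (i + 1)).nIn := by
        rw [show 2 * i + 2 + 1 = 2 * (i + 1) + 1 by ring, vtx_odd hi1, ptIn, innerPt_eq, (side_sIn hi1).1]
      rw [ek, ek1, sdot_cross_eq, Side.nIn_sq]
      -- `|m - w|² ≥ 2`
      suffices hd : 1 < (m.1 - (γ.vtx j).1) ^ 2 + (m.2 - (γ.vtx j).2) ^ 2 by omega
      rcases index_cases (γ := γ) j hj with rfl | ⟨i', hi', rfl⟩ | ⟨i', hi', rfl⟩ | rfl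
      · rw [vtx_zero]
        have := one_lt_dist_midPt (e := γ.mids[i + 1]'(lt_length_of_lt_arcs hi)) (e' := a) (by
          intro h; have := (γ.nodup.getElem_inj_iff).1 (h.trans γ.getElem_zero.symm); omega)
        simpa [hm] using this
      · rw [vtx_odd hi', ptIn]
        by_contra hle
        have hne := midPt_ne_innerPt (γ.mids[i + 1]'(lt_length_of_lt_arcs hi)) (γ.fc i') (γ.sIn i')
        have hpos : 0 < (m.1 - (innerPt (γ.fc i') (γ.sIn i')).1) ^ 2 + (m.2 - (innerPt (γ.fc i') (γ.sIn i')).2) ^ 2 := by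
          by_contra h0
          apply hne; rw [← hm]; ext <;> nlinarith [sq_nonneg (m.1 - (innerPt (γ.fc i') (γ.sIn i')).1),
            sq_nonneg (m.2 - (innerPt (γ.fc i') (γ.sIn i')).2)]
        have h1' : (m - innerPt (γ.fc i') (γ.sIn i')).1 ^ 2 + (m - innerPt (γ.fc i') (γ.sIn i')).2 ^ 2 = 1 := by
          simp only [Prod.fst_sub, Prod.snd_sub]; omega
        have hside := side_eq_of_dist_one h1'
        rw [(side_sIn hi').1] at hside
        have := (γ.nodup.getElem_inj_iff).1 hside
        subst this
        exact h2 (by ring)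
      · rw [vtx_even hi', ptOut]
        by_contra hle
        have hne := midPt_ne_innerPt (γ.mids[i + 1]'(lt_length_of_lt_arcs hi)) (γ.fc i') (γ.sOut i')
        have hpos : 0 < (m.1 - (innerPt (γ.fc i') (γ.sOut i')).1) ^ 2 + (m.2 - (innerPt (γ.fc i') (γ.sOut i')).2) ^ 2 := by
          by_contra h0
          apply hne; rw [← hm]; ext <;> nlinarith [sq_nonneg (m.1 - (innerPt (γ.fc i') (γ.sOut i')).1),
            sq_nonneg (m.2 - (innerPt (γ.fc i') (γ.sOut i')).2)]
        have h1' : (m - innerPt (γ.fc i') (γ.sOut i')).1 ^ 2 + (m - innerPt (γ.fc i') (γ.sOut i')).2 ^ 2 = 1 := by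
          simp only [Prod.fst_sub, Prod.snd_sub]; omega
        have hside := side_eq_of_dist_one h1'
        rw [(side_sIn hi').2.1] at hside
        have := (γ.nodup.getElem_inj_iff).1 hside
        have : i' = i := by omega
        subst this
        exact h1 rfl
      · rw [vtx_last]
        have := one_lt_dist_midPt (e := γ.mids[i + 1]'(lt_length_of_lt_arcs hi)) (e' := z) (by
          intro h; have := (γ.nodup.getElem_inj_iff).1 (h.trans γ.getElem_length_sub_one.symm)
          have := γ.length_arcs; omega)
        simpa [hm] using this
    · -- final half segment
      have hi' : i + 1 = γ.arcs.length := by omega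
      have ek : γ.vtx (2 * i + 2) = midPt z + (γ.sOut i).nIn := by
        rw [vtx_even hi, ptOut, innerPt_eq, (side_sIn hi).2.1]
        congr 2
        have hl := γ.getElem_length_sub_one
        have e : i + 1 = γ.mids.length - 1 := by have := γ.length_arcs; omega
        simp only [e]; exact hl
      have ek1 : γ.vtx (2 * i + 2 + 1) = midPt z := by
        rw [show 2 * i + 2 + 1 = 2 * γ.arcs.length + 1 by omega, vtx_last]
      rw [ek, ek1, sdot_comm]
      refine sdot_half_pos _ ?_ ?_
      · rw [← ek1]; exact hvj (by omega) h2
      · rw [← ek]; exact hvj (by omega) h1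
  · omega

end YBWalk



/-! ### Reduction of the winding to the right-angle tiling -/

/-- Indicator of the slanted sides `S, N` of a rhombus. [folklore] -/
def Side.slantInd : Side → ℝ
  | .W => 0
  | .E => 0
  | .S => 1
  | .N => 1

/-- The rotation of an arc depends on the angle `θ` only through the slantedness of its ends:
`turn_θ(s→t) − turn_{π/2}(s→t) = (θ − π/2)(𝟙[t slanted] − 𝟙[s slanted])`. [folklore] -/
theorem arcTurn_sub_arcTurn_pi_div_two (θ : ℝ) (s t : Side) :
    arcTurn θ s t - arcTurn (π / 2) s t = (θ - π / 2) * (t.slantInd - s.slantInd) := by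
  cases s <;> cases t <;> simp [arcTurn, Side.slantInd] <;> ring

/-- The potential `κ_Θ(e)`: `θ_k − π/2` on the slanted edges of column `k`, `0` on vertical edges.
[folklore] -/
def slantPot (Θ : ℤ → ℝ) : MidEdge → ℝ
  | .vert _ _ => 0
  | .slant k _ => Θ k - π / 2

/-- The potential of a side of a face. [folklore] -/
theorem slantPot_side (Θ : ℤ → ℝ) (f : Face) (s : Side) :
    slantPot Θ (f.side s) = (Θ f.1 - π / 2) * s.slantInd := by
  cases s <;> simp [slantPot, Face.side, Side.slantInd]

/-- **The rotation of an arc is that of the right-angle tiling plus a potential difference.**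
[folklore] -/
theorem arcTurnOf_sub_eq {Θ : ℤ → ℝ} {p : MidEdge × MidEdge} {f : Face} (hf : arcFace p = some f) :
    arcTurnOf Θ p - arcTurnOf (fun _ => π / 2) p = slantPot Θ p.2 - slantPot Θ p.1 := by
  obtain ⟨s, t, -, hs, ht, -⟩ := exists_sides_of_arcFace hf
  unfold arcTurnOf
  rw [hf]
  simp only [← hs, ← ht, Face.sideOf_side, slantPot_side]
  rw [arcTurn_sub_arcTurn_pi_div_two]
  ring

/-- Telescoping of potential differences along the arcs of a list. [folklore] -/
theorem sum_arcsOf_sub (κ : MidEdge → ℝ) : ∀ (l : List MidEdge) (hl : l ≠ []),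
    ((arcsOf l).map fun p => κ p.2 - κ p.1).sum = κ (l.getLast hl) - κ (l.head hl)
  | [x], _ => by simp [arcsOf]
  | x :: y :: l, _ => by
    rw [arcsOf_cons_cons, List.map_cons, List.sum_cons, sum_arcsOf_sub κ (y :: l) (by simp),
      List.getLast_cons (List.cons_ne_nil y l)]
    simp

namespace YBWalk

variable {D : Set Face} {a z : MidEdge}

/-- The first mid-edge is the head. [folklore] -/
theorem head_mids (γ : YBWalk D a z) : γ.mids.head γ.mids_ne_nil = a := by
  have := γ.head_eq
  rw [List.head?_eq_some_head γ.mids_ne_nil, Option.some.injEq] at this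
  exact this

/-- The last mid-edge is the endpoint. [folklore] -/
theorem getLast_mids (γ : YBWalk D a z) : γ.mids.getLast γ.mids_ne_nil = z := by
  have := γ.getLast_eq
  rw [List.getLast?_eq_some_getLast γ.mids_ne_nil, Option.some.injEq] at this
  exact this

/-- **The winding depends on the angles only through the end edges**:
`wind_Θ(γ) = wind_{π/2}(γ) + κ_Θ(end) − κ_Θ(start)`, `κ_Θ = (θ_k − π/2)·𝟙[slanted edge of column k]`
(the potential `θ_k − π/2` of the slanted edges telescopes along the walk, consecutive arcs at a
slanted edge lying in the same column). [folklore] -/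
theorem winding_eq_winding_pi_div_two_add (Θ : ℤ → ℝ) (γ : YBWalk D a z) :
    γ.winding Θ = γ.winding (fun _ => π / 2) + slantPot Θ z - slantPot Θ a := by
  have hsub : ∀ l : List (MidEdge × MidEdge), (∀ p ∈ l, ∃ f, arcFace p = some f) →
      (l.map (arcTurnOf Θ)).sum - (l.map (arcTurnOf fun _ => π / 2)).sum =
        (l.map fun p => slantPot Θ p.2 - slantPot Θ p.1).sum := by
    intro l hl
    induction l with
    | nil => simp
    | cons p l ih =>
      simp only [List.map_cons, List.sum_cons]
      obtain ⟨f, hf⟩ := hl p (by simp)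
      rw [← arcTurnOf_sub_eq hf, ← ih fun q hq => hl q (by simp [hq])]
      ring
  have h : γ.winding Θ - γ.winding (fun _ => π / 2) = slantPot Θ z - slantPot Θ a := by
    have e := sum_arcsOf_sub (slantPot Θ) γ.mids γ.mids_ne_nil
    rw [γ.getLast_mids, γ.head_mids] at e
    rw [winding, winding, hsub _ fun p hp => ?_, ← e]
    obtain ⟨f, -, hf⟩ := γ.arc_mem p hp
    exact ⟨f, hf⟩
  linarith

end YBWalk


open Complex

/-! ### Arguments of the eight lattice directions -/

/-- `√2 · √2 = 2` in `ℂ`. [folklore] -/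
theorem sqrt_two_mul_sqrt_two_C : (Real.sqrt 2 : ℂ) * (Real.sqrt 2 : ℂ) = 2 := by
  rw [← Complex.ofReal_mul, Real.mul_self_sqrt (by norm_num)]; norm_num

/-- `arg(1 + i) = π/4`. [folklore] -/
theorem arg_one_add_I : Complex.arg (1 + I) = π / 4 := by
  have h : (1 : ℂ) + I = (Real.sqrt 2 : ℝ) * (Complex.cos ((π / 4 : ℝ)) + Complex.sin ((π / 4 : ℝ)) * I) := by
    rw [← Complex.ofReal_cos, ← Complex.ofReal_sin, Real.cos_pi_div_four, Real.sin_pi_div_four]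
    push_cast
    linear_combination (-(1 + I) / 2) * sqrt_two_mul_sqrt_two_C
  rw [h, Complex.arg_mul_cos_add_sin_mul_I (by positivity) ⟨by linarith [Real.pi_pos], by linarith [Real.pi_pos]⟩]

/-- `arg(1 − i) = −π/4`. [folklore] -/
theorem arg_one_sub_I : Complex.arg (1 - I) = -(π / 4) := by
  have h : (1 : ℂ) - I = (Real.sqrt 2 : ℝ) * (Complex.cos ((-(π / 4) : ℝ)) + Complex.sin ((-(π / 4) : ℝ)) * I) := by
    rw [← Complex.ofReal_cos, ← Complex.ofReal_sin, Real.cos_neg, Real.sin_neg, Real.cos_pi_div_four,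
      Real.sin_pi_div_four]
    push_cast
    linear_combination (-(1 - I) / 2) * sqrt_two_mul_sqrt_two_C
  rw [h, Complex.arg_mul_cos_add_sin_mul_I (by positivity) ⟨by linarith [Real.pi_pos], by linarith [Real.pi_pos]⟩]

/-- `arg(−1 + i) = 3π/4`. [folklore] -/
theorem arg_neg_one_add_I : Complex.arg (-1 + I) = 3 * π / 4 := by
  have h : (-1 : ℂ) + I = (Real.sqrt 2 : ℝ) * (Complex.cos ((3 * π / 4 : ℝ)) + Complex.sin ((3 * π / 4 : ℝ)) * I) := by
    rw [← Complex.ofReal_cos, ← Complex.ofReal_sin, show (3 * π / 4 : ℝ) = π - π / 4 by ring, Real.cos_pi_sub,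
      Real.sin_pi_sub, Real.cos_pi_div_four, Real.sin_pi_div_four]
    push_cast
    linear_combination (-(-1 + I) / 2) * sqrt_two_mul_sqrt_two_C
  rw [h, Complex.arg_mul_cos_add_sin_mul_I (by positivity) ⟨by linarith [Real.pi_pos], by linarith [Real.pi_pos]⟩]

/-- `arg(−1 − i) = −3π/4`. [folklore] -/
theorem arg_neg_one_sub_I : Complex.arg (-1 - I) = -(3 * π / 4) := by
  have h : (-1 : ℂ) - I = (Real.sqrt 2 : ℝ) * (Complex.cos ((-(3 * π / 4)) : ℝ) + Complex.sin ((-(3 * π / 4)) : ℝ) * I) := by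
    rw [← Complex.ofReal_cos, ← Complex.ofReal_sin, Real.cos_neg, Real.sin_neg,
      show (3 * π / 4 : ℝ) = π - π / 4 by ring, Real.cos_pi_sub, Real.sin_pi_sub, Real.cos_pi_div_four,
      Real.sin_pi_div_four]
    push_cast
    linear_combination (-(-1 - I) / 2) * sqrt_two_mul_sqrt_two_C
  rw [h, Complex.arg_mul_cos_add_sin_mul_I (by positivity) ⟨by linarith [Real.pi_pos], by linarith [Real.pi_pos]⟩]

/-- `toReal` of a difference of two real angles in `(−π, π]`. [folklore] -/
theorem toReal_coe_sub_coe {x y : ℝ} (h : -π < x - y ∧ x - y ≤ π) :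
    ((x : Real.Angle) - (y : Real.Angle)).toReal = x - y := by
  rw [← Real.Angle.coe_sub, Real.Angle.toReal_coe_eq_self_iff.2 h]

/-- `toReal` of a difference of two real angles in `(−3π, −π]`. [folklore] -/
theorem toReal_coe_sub_coe_add {x y : ℝ} (h : -π < x - y + 2 * π ∧ x - y + 2 * π ≤ π) :
    ((x : Real.Angle) - (y : Real.Angle)).toReal = x - y + 2 * π := by
  rw [← Real.Angle.coe_sub, ← Real.Angle.toReal_coe_eq_self_iff.2 h, Real.Angle.coe_add, Real.Angle.coe_two_pi,
    add_zero]

/-- `toReal` of a difference of two real angles in `(π, 3π]`. [folklore] -/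
theorem toReal_coe_sub_coe_sub {x y : ℝ} (h : -π < x - y - 2 * π ∧ x - y - 2 * π ≤ π) :
    ((x : Real.Angle) - (y : Real.Angle)).toReal = x - y - 2 * π := by
  rw [← Real.Angle.coe_sub, ← Real.Angle.toReal_coe_eq_self_iff.2 h, Real.Angle.coe_sub (x - y), Real.Angle.coe_two_pi,
    sub_zero]

/-- `arg 2 = 0`. [folklore] -/
theorem arg_two : Complex.arg (2 : ℂ) = 0 := by
  rw [show (2 : ℂ) = ((2 : ℝ) : ℂ) by norm_num, Complex.arg_ofReal_of_nonneg (by norm_num)]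

/-- `arg (−2) = π`. [folklore] -/
theorem arg_neg_two : Complex.arg (-2 : ℂ) = π := by
  rw [show (-2 : ℂ) = ((-2 : ℝ) : ℂ) by norm_num, Complex.arg_ofReal_of_neg (by norm_num)]

/-- `arg (2i) = π/2`. [folklore] -/
theorem arg_two_mul_I : Complex.arg (2 * I) = π / 2 := by
  rw [show (2 : ℂ) * I = ((2 : ℝ) : ℂ) * I by norm_num, Complex.arg_real_mul _ (by norm_num), Complex.arg_I]

/-- `arg (−2i) = −π/2`. [folklore] -/
theorem arg_neg_two_mul_I : Complex.arg (-(2 * I)) = -(π / 2) := by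
  rw [show -((2 : ℂ) * I) = ((2 : ℝ) : ℂ) * (-I) by push_cast; ring, Complex.arg_real_mul _ (by norm_num),
    Complex.arg_neg_I]



/-! ### Exterior angles of the polyline -/

/-- Gaussian integers as complex numbers. [folklore] -/
def toC (p : ℤ × ℤ) : ℂ := (p.1 : ℂ) + (p.2 : ℂ) * I

/-- `toC` is additive. [folklore] -/
@[simp] theorem toC_add (p q : ℤ × ℤ) : toC (p + q) = toC p + toC q := by simp [toC]; ring
/-- `toC` respects subtraction. [folklore] -/
@[simp] theorem toC_sub (p q : ℤ × ℤ) : toC (p - q) = toC p - toC q := by simp [toC]; ring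
/-- `toC` respects negation. [folklore] -/
@[simp] theorem toC_neg (p : ℤ × ℤ) : toC (-p) = -toC p := by simp [toC]; ring

/-- The real part of `toC x · conj (toC y)` is the dot product. [folklore] -/
theorem re_toC_mul_conj (x y : ℤ × ℤ) : (toC x * (starRingEnd ℂ) (toC y)).re = x.1 * y.1 + x.2 * y.2 := by
  simp [toC, Complex.mul_re]

/-- The chord of an arc in the right-angle drawing, relative to its face. [folklore] -/
def chordVec (s t : Side) : ℤ × ℤ := t.inOff - s.inOff

/-- `arg(1 − i) = −π/4` (additive form). [folklore] -/
theorem arg_one_add_neg_I : Complex.arg (1 + -I) = -(π / 4) := by rw [← sub_eq_add_neg, arg_one_sub_I]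

/-- `arg(−1 − i) = −3π/4` (additive form). [folklore] -/
theorem arg_neg_one_add_neg_I : Complex.arg (-1 + -I) = -(3 * π / 4) := by rw [← sub_eq_add_neg, arg_neg_one_sub_I]

/-- Evaluation of `toReal` of a real angle in `(−π, π]`. [folklore] -/
theorem toReal_coe_of_mem {x : ℝ} (h : -π < x ∧ x ≤ π) : (x : Real.Angle).toReal = x :=
  Real.Angle.toReal_coe_eq_self_iff.2 h

/-- Evaluation of `toReal` of a real angle in `(−3π, −π]`. [folklore] -/
theorem toReal_coe_of_mem_add {x : ℝ} (h : -π < x + 2 * π ∧ x + 2 * π ≤ π) : (x : Real.Angle).toReal = x + 2 * π := by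
  rw [← toReal_coe_of_mem h, Real.Angle.coe_add, Real.Angle.coe_two_pi, add_zero]

/-- Evaluation of `toReal` of a real angle in `(π, 3π]`. [folklore] -/
theorem toReal_coe_of_mem_sub {x : ℝ} (h : -π < x - 2 * π ∧ x - 2 * π ≤ π) : (x : Real.Angle).toReal = x - 2 * π := by
  rw [← toReal_coe_of_mem h, Real.Angle.coe_sub, Real.Angle.coe_two_pi, sub_zero]

/-- **The two exterior angles of an arc add up to its rotation**: at the entry inner point between
the normal and the chord, at the exit inner point between the chord and the outward normal.
[folklore] -/
theorem ext_angles_eq_arcTurn (s t : Side) (hst : s ≠ t) :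
    ((Complex.arg (toC (chordVec s t)) : Real.Angle) - (Complex.arg (toC s.nIn) : Real.Angle)).toReal +
      ((Complex.arg (-toC t.nIn) : Real.Angle) - (Complex.arg (toC (chordVec s t)) : Real.Angle)).toReal =
        arcTurn (π / 2) s t := by
  have hpi := Real.pi_pos
  cases s <;> cases t <;> simp only [ne_eq, not_true_eq_false] at hst <;>
    simp only [toC, chordVec, Side.inOff, Side.offset, Side.nIn, arcTurn, Prod.mk_add_mk, Prod.mk_sub_mk,
      Int.cast_zero, Int.cast_one, Int.cast_neg, zero_mul, add_zero, one_mul, zero_add] <;>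
    norm_num
  case W.S =>
    rw [arg_one_add_neg_I]
    simp only [← Real.Angle.coe_neg, ← Real.Angle.coe_sub]
    rw [toReal_coe_of_mem (by constructor <;> linarith)]; ring
  case W.N =>
    rw [arg_one_add_I]
    simp only [← Real.Angle.coe_sub]
    rw [toReal_coe_of_mem (by constructor <;> linarith)]; ring
  case E.W =>
    rw [arg_neg_two]
    simp only [← Real.Angle.coe_sub]
    rw [toReal_coe_of_mem (by constructor <;> linarith)]; ring
  case E.S =>
    rw [arg_neg_one_add_neg_I]
    simp only [← Real.Angle.coe_neg, ← Real.Angle.coe_sub]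
    rw [toReal_coe_of_mem_add (by constructor <;> linarith), toReal_coe_of_mem (by constructor <;> linarith)]; ring
  case E.N =>
    rw [arg_neg_one_add_I]
    simp only [← Real.Angle.coe_sub]
    rw [toReal_coe_of_mem (by constructor <;> linarith), toReal_coe_of_mem (by constructor <;> linarith)]; ring
  case S.W =>
    rw [arg_neg_one_add_I]
    simp only [← Real.Angle.coe_sub]
    rw [toReal_coe_of_mem (by constructor <;> linarith), toReal_coe_of_mem (by constructor <;> linarith)]; ring
  case S.E =>
    rw [arg_one_add_I]
    simp only [← Real.Angle.coe_neg, ← Real.Angle.coe_sub]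
    rw [toReal_coe_of_mem (by constructor <;> linarith), toReal_coe_of_mem (by constructor <;> linarith)]; ring
  case S.N =>
    rw [arg_two_mul_I]
    simp
  case N.W =>
    rw [arg_neg_one_add_neg_I]
    simp only [← Real.Angle.coe_sub, ← Real.Angle.coe_add]
    rw [toReal_coe_of_mem (by constructor <;> linarith), toReal_coe_of_mem_sub (by constructor <;> linarith)]; ring
  case N.E =>
    rw [arg_one_add_neg_I]
    simp only [← Real.Angle.coe_neg, ← Real.Angle.coe_add]
    rw [toReal_coe_of_mem (by constructor <;> linarith), toReal_coe_of_mem (by constructor <;> linarith)]; ring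
  case N.S =>
    rw [arg_neg_two_mul_I]
    simp


/-- `arcTurnOf` through the total face/side functions. [folklore] -/
theorem arcTurnOf_eq_arcTurn {Θ : ℤ → ℝ} {p : MidEdge × MidEdge} {f : Face} (h : arcFace p = some f) :
    arcTurnOf Θ p = arcTurn (Θ f.1) (sideIn p) (sideOut p) := by
  obtain ⟨hs, ht, -⟩ := side_sideIn h
  unfold arcTurnOf
  rw [h]
  simp only
  conv_lhs => rw [← hs, ← ht, Face.sideOf_side, Face.sideOf_side]

/-- A list sum as a sum over indices. [folklore] -/
theorem List.sum_map_eq_sum_range_getD {α M : Type*} [AddCommMonoid M] (f : α → M) (d : α) :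
    ∀ l : List α, (l.map f).sum = ∑ i ∈ Finset.range l.length, f (l.getD i d)
  | [] => by simp
  | x :: l => by
    rw [List.map_cons, List.sum_cons, List.length_cons, Finset.sum_range_succ', List.sum_map_eq_sum_range_getD f d l]
    simp [add_comm]

namespace YBWalk

variable {D : Set Face} {a z : MidEdge} {γ : YBWalk D a z}

/-- The winding as a sum over the arcs, through their entry and exit sides. [folklore] -/
theorem winding_eq_sum (Θ : ℤ → ℝ) :
    γ.winding Θ = ∑ i ∈ Finset.range γ.arcs.length, arcTurn (Θ (γ.fc i).1) (γ.sIn i) (γ.sOut i) := by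
  rw [winding, List.sum_map_eq_sum_range_getD _ (a, a)]
  refine Finset.sum_congr rfl fun i hi => ?_
  rw [Finset.mem_range] at hi
  exact arcTurnOf_eq_arcTurn (arcFace_arcAt hi).1

/-- The complex polyline. [folklore] -/
def cvtx (γ : YBWalk D a z) (j : ℕ) : ℂ := toC (γ.vtx j)

/-- The chord of the arc `i`. [folklore] -/
theorem cvtx_chord {i : ℕ} (hi : i < γ.arcs.length) :
    γ.cvtx (2 * i + 2) - γ.cvtx (2 * i + 1) = toC (chordVec (γ.sIn i) (γ.sOut i)) := by
  rw [cvtx, cvtx, vtx_even hi, vtx_odd hi, ← toC_sub, ptOut, ptIn, innerPt, innerPt, chordVec]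
  congr 1; abel

/-- The segment into the arc `i` is a positive multiple of the inward normal. [folklore] -/
theorem cvtx_in {i : ℕ} (hi : i < γ.arcs.length) :
    ∃ c : ℝ, 0 < c ∧ γ.cvtx (2 * i + 1) - γ.cvtx (2 * i) = c * toC (γ.sIn i).nIn := by
  rcases Nat.eq_zero_or_pos i with rfl | hpos
  · refine ⟨1, one_pos, ?_⟩
    rw [cvtx, cvtx, vtx_odd hi, mul_zero, vtx_zero, ptIn, innerPt_eq, (side_sIn hi).1, γ.getElem_zero]
    push_cast; rw [toC_add]; ring
  · obtain ⟨i, rfl⟩ : ∃ i', i = i' + 1 := ⟨i - 1, by omega⟩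
    have hi0 : i < γ.arcs.length := by omega
    refine ⟨2, two_pos, ?_⟩
    have eν : (γ.sIn (i + 1)).nIn = -(γ.sOut i).nIn :=
      nIn_eq_neg_of_side_eq (((side_sIn hi0).2.1).trans ((side_sIn hi).1).symm) (fc_succ_ne hi)
    rw [cvtx, cvtx, vtx_odd hi, show 2 * (i + 1) = 2 * i + 2 by ring, vtx_even hi0, ptIn, ptOut, innerPt_eq,
      innerPt_eq, (side_sIn hi).1, (side_sIn hi0).2.1, eν, ← toC_sub]
    push_cast
    rw [show ∀ m ν : ℤ × ℤ, m + -ν - (m + ν) = -(ν + ν) from fun m ν => by abel, toC_neg, toC_neg, toC_add]; ring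

/-- The segment out of the arc `i` is a positive multiple of the outward normal. [folklore] -/
theorem cvtx_out {i : ℕ} (hi : i < γ.arcs.length) :
    ∃ c : ℝ, 0 < c ∧ γ.cvtx (2 * i + 3) - γ.cvtx (2 * i + 2) = c * (-toC (γ.sOut i).nIn) := by
  rcases Nat.lt_or_ge (i + 1) γ.arcs.length with hi1 | hi1
  · refine ⟨2, two_pos, ?_⟩
    have eν : (γ.sIn (i + 1)).nIn = -(γ.sOut i).nIn :=
      nIn_eq_neg_of_side_eq (((side_sIn hi).2.1).trans ((side_sIn hi1).1).symm) (fc_succ_ne hi1)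
    rw [cvtx, cvtx, show 2 * i + 3 = 2 * (i + 1) + 1 by ring, vtx_odd hi1, vtx_even hi, ptIn, ptOut, innerPt_eq,
      innerPt_eq, (side_sIn hi).2.1, (side_sIn hi1).1, eν, ← toC_sub]
    push_cast
    rw [show ∀ m ν : ℤ × ℤ, m + -ν - (m + ν) = -(ν + ν) from fun m ν => by abel, toC_neg, toC_add]; ring
  · refine ⟨1, one_pos, ?_⟩
    have e : γ.vtx (2 * i + 2) = midPt z + (γ.sOut i).nIn := by
      rw [vtx_even hi, ptOut, innerPt_eq, (side_sIn hi).2.1]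
      congr 2
      have hl := γ.getElem_length_sub_one
      have e : i + 1 = γ.mids.length - 1 := by have := γ.length_arcs; omega
      simp only [e]; exact hl
    rw [cvtx, cvtx, show 2 * i + 3 = 2 * γ.arcs.length + 1 by omega, vtx_last, e, ← toC_sub]
    push_cast
    rw [show ∀ m ν : ℤ × ℤ, m - (m + ν) = -ν from fun m ν => by abel, toC_neg]; ring

/-- **The total turning of the polyline is the right-angle winding of the walk.** [folklore] -/
theorem sum_ext_angles_eq_winding :
    ∑ j ∈ Finset.range (2 * γ.arcs.length),
      ((Complex.arg (γ.cvtx (j + 2) - γ.cvtx (j + 1)) : Real.Angle) -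
        (Complex.arg (γ.cvtx (j + 1) - γ.cvtx j) : Real.Angle)).toReal = γ.winding (fun _ => π / 2) := by
  rw [winding_eq_sum]
  -- pair the terms `2i` and `2i + 1`
  have hpair : ∀ (g : ℕ → ℝ) (n : ℕ), ∑ j ∈ Finset.range (2 * n), g j =
      ∑ i ∈ Finset.range n, (g (2 * i) + g (2 * i + 1)) := by
    intro g n
    induction n with
    | zero => simp
    | succ n ih => rw [show 2 * (n + 1) = 2 * n + 1 + 1 by ring, Finset.sum_range_succ, Finset.sum_range_succ, ih,
        Finset.sum_range_succ]; ring
  rw [hpair]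
  refine Finset.sum_congr rfl fun i hi => ?_
  rw [Finset.mem_range] at hi
  obtain ⟨c₁, hc₁, h₁⟩ := cvtx_in hi
  obtain ⟨c₂, hc₂, h₂⟩ := cvtx_out hi
  rw [show 2 * i + 1 + 1 = 2 * i + 2 by ring, show 2 * i + 1 + 2 = 2 * i + 3 by ring, cvtx_chord hi, h₁, h₂,
    Complex.arg_real_mul _ hc₁, Complex.arg_real_mul _ hc₂]
  exact ext_angles_eq_arcTurn _ _ (side_sIn hi).2.2

end YBWalk

/-! ### Hopf's evaluation of the total turning -/

open Hopf in
/-- **Hopf's evaluation for a polyline satisfying the subtended-angle condition**: if all vertices lie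
in a closed half-plane seen from the start and in a closed half-plane seen from the end, the total
turning is `arg(c₂ t₁) − arg(c₂ D) + arg(c₁ D) − arg(c₁ t₀)` (`t₀, t₁` the first and last segments,
`D` the chord). [folklore] -/
theorem hopf_eval (q : ℕ → ℂ) (m : ℕ)
    (hsub : ∀ k j : ℕ, k ≤ m → j ≤ m + 1 → j ≠ k → j ≠ k + 1 →
      0 < ((q (k + 1) - q j) * (starRingEnd ℂ) (q k - q j)).re)
    (hq : ∀ i j : ℕ, i ≤ m + 1 → j ≤ m + 1 → i ≠ j → q i ≠ q j)
    {c₁ c₂ : ℂ} (hc₁ : c₁ ≠ 0) (hc₂ : c₂ ≠ 0)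
    (h₁ : ∀ i ≤ m + 1, 0 ≤ (c₁ * (q i - q 0)).im) (h₂ : ∀ i ≤ m + 1, 0 ≤ (c₂ * (q (m + 1) - q i)).im) :
    ∑ j ∈ Finset.range m, ((Complex.arg (q (j + 2) - q (j + 1)) : Real.Angle) -
        (Complex.arg (q (j + 1) - q j) : Real.Angle)).toReal =
      Complex.arg (c₂ * (q (m + 1) - q m)) - Complex.arg (c₂ * (q (m + 1) - q 0)) +
        (Complex.arg (c₁ * (q (m + 1) - q 0)) - Complex.arg (c₁ * (q 1 - q 0))) := by
  have hne : ∀ i j, i ≤ m + 1 → j ≤ m + 1 → i ≠ j → q i - q j ≠ 0 :=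
    fun i j hi hj hij h => hq i j hi hj hij (sub_eq_zero.1 h)
  rw [hopf_open q m hsub]
  congr 1
  · have := sum_toReal_argDiff_eq hc₂ (fun i => q (m + 1) - q i) m
      (fun i hi => hne (m + 1) i le_rfl (by omega) (by omega)) (fun i hi => h₂ i (by omega)) ?_
    · simpa using this
    · intro i hi
      refine lt_of_lt_of_le (abs_toReal_argDiff_lt ?_) (by linarith [Real.pi_pos])
      have := hsub i (m + 1) (by omega) le_rfl (by omega) (by omega)
      rwa [show q (i + 1) - q (m + 1) = -(q (m + 1) - q (i + 1)) by ring,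
        show q i - q (m + 1) = -(q (m + 1) - q i) by ring, map_neg, neg_mul_neg] at this
  · have := sum_toReal_argDiff_eq hc₁ (fun i => q (i + 1) - q 0) m
      (fun i hi => hne (i + 1) 0 (by omega) (by omega) (by omega)) (fun i hi => h₁ (i + 1) (by omega)) ?_
    · simpa using this
    · intro i hi
      refine lt_of_lt_of_le (abs_toReal_argDiff_lt ?_) (by linarith [Real.pi_pos])
      exact hsub (i + 1) 0 (by omega) (by omega) (by omega) (by omega)


/-! ### Walks of the rectangle from the origin -/

/-- Real part of `toC`. [folklore] -/
@[simp] theorem toC_re (p : ℤ × ℤ) : (toC p).re = p.1 := by simp [toC]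
/-- Imaginary part of `toC`. [folklore] -/
@[simp] theorem toC_im (p : ℤ × ℤ) : (toC p).im = p.2 := by simp [toC]

/-- `toC` is injective. [folklore] -/
theorem toC_injective : Function.Injective toC := by
  intro p q h
  have h1 := congrArg Complex.re h
  have h2 := congrArg Complex.im h
  simp only [toC_re, toC_im, Int.cast_inj] at h1 h2
  exact Prod.ext h1 h2

/-- A vertical edge of the boundary `x = 0` is the `W` side of its face in the half-plane. [folklore] -/
theorem side_eq_W_of_vert_zero {f : Face} {s : Side} {j : ℤ} (h : f.side s = .vert 0 j) (hf : 0 ≤ f.1) : s = .W := by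
  obtain ⟨k, j'⟩ := f
  cases s <;> simp only [Face.side, MidEdge.vert.injEq, reduceCtorEq] at h hf ⊢; omega

namespace YBWalk

variable {T L : ℕ} {z : MidEdge} {γ : YBWalk (rect T L) origin z}

/-- The faces of the arcs lie in the rectangle. [folklore] -/
theorem fc_mem {i : ℕ} (hi : i < γ.arcs.length) :
    0 ≤ (γ.fc i).1 ∧ (γ.fc i).1 < T ∧ -(L : ℤ) ≤ (γ.fc i).2 ∧ (γ.fc i).2 ≤ L := (arcFace_arcAt hi).2

/-- The inner vertices of the polyline lie in the rectangle `[1, 4T-1] × [-4L+1, 4L+3]`. [folklore] -/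
theorem vtx_inner_mem {j : ℕ} (hj1 : 1 ≤ j) (hj2 : j ≤ 2 * γ.arcs.length) :
    1 ≤ (γ.vtx j).1 ∧ (γ.vtx j).1 ≤ 4 * T - 1 ∧ -4 * (L : ℤ) + 1 ≤ (γ.vtx j).2 ∧ (γ.vtx j).2 ≤ 4 * L + 3 := by
  obtain ⟨i, hi, σ, e⟩ : ∃ i, i < γ.arcs.length ∧ ∃ σ : Side, γ.vtx j = innerPt (γ.fc i) σ := by
    rcases index_cases (γ := γ) j (by omega) with h | ⟨i, hi, rfl⟩ | ⟨i, hi, rfl⟩ | h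
    · omega
    · exact ⟨i, hi, _, vtx_odd hi⟩
    · exact ⟨i, hi, _, vtx_even hi⟩
    · omega
  rw [e]
  obtain ⟨h1, h2, h3, h4⟩ := fc_mem hi
  have hσ := σ.inOff_mem
  have hσ1 : 1 ≤ σ.inOff.1 ∧ 1 ≤ σ.inOff.2 := by cases σ <;> simp [Side.inOff, Side.offset, Side.nIn]
  simp only [innerPt, Face.base, Prod.fst_add, Prod.snd_add]
  omega

/-- A walk from the origin enters its first face through the `W` side. [folklore] -/
theorem sIn_zero (hn : 0 < γ.arcs.length) : γ.sIn 0 = .W :=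
  side_eq_W_of_vert_zero ((side_sIn hn).1.trans γ.getElem_zero) (fc_mem hn).1

/-- The first segment is the unit normal `1`. [folklore] -/
theorem cvtx_one_sub (hn : 0 < γ.arcs.length) : γ.cvtx 1 - γ.cvtx 0 = 1 := by
  rw [cvtx, cvtx, show (1 : ℕ) = 2 * 0 + 1 from rfl, vtx_odd hn, vtx_zero, ptIn, innerPt_eq, (side_sIn hn).1,
    γ.getElem_zero, sIn_zero hn, ← toC_sub, add_sub_cancel_left]
  simp [toC, Side.nIn]

/-- The last segment is the outward normal at the final edge. [folklore] -/
theorem cvtx_last_sub (hn : 0 < γ.arcs.length) :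
    γ.cvtx (2 * γ.arcs.length + 1) - γ.cvtx (2 * γ.arcs.length) = -toC (γ.sOut (γ.arcs.length - 1)).nIn := by
  have e : γ.vtx (2 * (γ.arcs.length - 1) + 2) = midPt z + (γ.sOut (γ.arcs.length - 1)).nIn := by
    rw [vtx_even (by omega), ptOut, innerPt_eq, (side_sIn (show γ.arcs.length - 1 < γ.arcs.length by omega)).2.1]
    congr 2
    have hl := γ.getElem_length_sub_one
    have e : γ.arcs.length - 1 + 1 = γ.mids.length - 1 := by have := γ.length_arcs; omega
    simp only [e]; exact hl
  rw [cvtx, cvtx, vtx_last, show 2 * γ.arcs.length = 2 * (γ.arcs.length - 1) + 2 by omega, e, ← toC_sub]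
  rw [show ∀ m ν : ℤ × ℤ, m - (m + ν) = -ν from fun m ν => by abel, toC_neg]

/-- The exit side of the last arc is determined by the final edge. [folklore] -/
theorem side_sOut_last (hn : 0 < γ.arcs.length) : (γ.fc (γ.arcs.length - 1)).side (γ.sOut (γ.arcs.length - 1)) = z := by
  rw [(side_sIn (show γ.arcs.length - 1 < γ.arcs.length by omega)).2.1]
  have hl := γ.getElem_length_sub_one
  have e : γ.arcs.length - 1 + 1 = γ.mids.length - 1 := by have := γ.length_arcs; omega
  simp only [e]; exact hl

/-- All vertices of the polyline have abscissa `≥ 0`. [folklore] -/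
theorem vtx_fst_nonneg (hn : 0 < γ.arcs.length) {i : ℕ} (hi : i ≤ 2 * γ.arcs.length + 1) : 0 ≤ (γ.vtx i).1 := by
  rcases Nat.eq_zero_or_pos i with rfl | hpos
  · simp [vtx_zero, midPt, origin]
  · rcases Nat.lt_or_ge i (2 * γ.arcs.length + 1) with h | h
    · have := (vtx_inner_mem (γ := γ) hpos (by omega)).1; omega
    · have : i = 2 * γ.arcs.length + 1 := by omega
      subst this
      rw [vtx_last, ← side_sOut_last hn]
      obtain ⟨h1, -, -, -⟩ := fc_mem (γ := γ) (show γ.arcs.length - 1 < γ.arcs.length by omega)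
      rw [midPt_side]
      cases γ.sOut (γ.arcs.length - 1) <;> simp [Face.base, Side.offset] <;> omega

/-- The vertices of the polyline: the start, inner points, or the end. [folklore] -/
theorem vtx_trichotomy {j : ℕ} (hj : j ≤ 2 * γ.arcs.length + 1) :
    γ.vtx j = midPt origin ∨
      (1 ≤ (γ.vtx j).1 ∧ (γ.vtx j).1 ≤ 4 * T - 1 ∧ -4 * (L : ℤ) + 1 ≤ (γ.vtx j).2 ∧ (γ.vtx j).2 ≤ 4 * L + 3) ∨
      γ.vtx j = midPt z := by
  rcases Nat.eq_zero_or_pos j with rfl | hpos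
  · left; exact vtx_zero
  · rcases Nat.lt_or_ge j (2 * γ.arcs.length + 1) with h | h
    · right; left; exact vtx_inner_mem hpos (by omega)
    · right; right; rw [show j = 2 * γ.arcs.length + 1 by omega, vtx_last]

/-- **The right-angle winding through Hopf's formula**, for a walk of the rectangle from the origin
all of whose vertices lie in a closed half-plane seen from its end. [folklore] -/
theorem winding_pi_div_two_eq (hn : 0 < γ.arcs.length) {c₂ : ℂ} (hc₂ : c₂ ≠ 0)
    (h₂ : ∀ j ≤ 2 * γ.arcs.length + 1, 0 ≤ (c₂ * (γ.cvtx (2 * γ.arcs.length + 1) - γ.cvtx j)).im) :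
    γ.winding (fun _ => π / 2) =
      Complex.arg (c₂ * -toC (γ.sOut (γ.arcs.length - 1)).nIn) -
          Complex.arg (c₂ * (toC (midPt z) - toC (midPt origin))) +
        (Complex.arg (I * (toC (midPt z) - toC (midPt origin))) - Complex.arg I) := by
  have key := hopf_eval γ.cvtx (2 * γ.arcs.length) ?_ ?_ Complex.I_ne_zero hc₂ ?_ h₂
  · rw [sum_ext_angles_eq_winding, cvtx_last_sub hn, cvtx_one_sub hn, mul_one] at key
    rw [key, cvtx, cvtx, vtx_last, vtx_zero]
  · intro k j hk hj h1 h2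
    rw [cvtx, cvtx, cvtx, ← toC_sub, ← toC_sub, re_toC_mul_conj]
    have := subtended hk hj h1 h2 hn
    simp only [sdot] at this
    simp only [Prod.fst_sub, Prod.snd_sub]
    exact_mod_cast this
  · intro i j hi hj hij h
    exact hij (vtx_injective hi hj hn (toC_injective h))
  · intro i hi
    rw [cvtx, cvtx, ← toC_sub, Complex.mul_im, Complex.I_re, Complex.I_im, zero_mul, one_mul, zero_add, toC_re,
      Prod.fst_sub, vtx_zero]
    -- all vertices have abscissa `≥ 0 = (midPt origin).1`
    have : 0 ≤ (γ.vtx i).1 := vtx_fst_nonneg hn hi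
    have e : (midPt origin).1 = 0 := by simp [midPt, origin]
    rw [e]; push_cast
    have : (0 : ℝ) ≤ ((γ.vtx i).1 : ℝ) := by exact_mod_cast this
    linarith

end YBWalk


/-- A vertical edge of the right boundary `x = T` is the `E` side of its face in the strip. [folklore] -/
theorem side_eq_E_of_vert {f : Face} {s : Side} {T : ℕ} {j : ℤ} (h : f.side s = .vert T j) (hf : f.1 < T) : s = .E := by
  obtain ⟨k, j'⟩ := f
  cases s
  · simp only [Face.side, MidEdge.vert.injEq] at h; simp only at hf; omega
  · rfl
  · simp [Face.side] at h
  · simp [Face.side] at h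

/-- A slanted edge above its face is its `N` side. [folklore] -/
theorem side_eq_N_of_slant {f : Face} {s : Side} {k r : ℤ} (h : f.side s = .slant k r) (hf : f.2 < r) :
    s = .N ∧ f = (k, r - 1) := by
  obtain ⟨k', j'⟩ := f
  cases s
  · simp [Face.side] at h
  · simp [Face.side] at h
  · simp only [Face.side, MidEdge.slant.injEq] at h; simp only at hf; omega
  · simp only [Face.side, MidEdge.slant.injEq] at h
    exact ⟨rfl, Prod.ext h.1 (by simp; omega)⟩

/-- A slanted edge below its face is its `S` side. [folklore] -/
theorem side_eq_S_of_slant {f : Face} {s : Side} {k r : ℤ} (h : f.side s = .slant k r) (hf : r ≤ f.2) :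
    s = .S ∧ f = (k, r) := by
  obtain ⟨k', j'⟩ := f
  cases s
  · simp [Face.side] at h
  · simp [Face.side] at h
  · simp only [Face.side, MidEdge.slant.injEq] at h
    exact ⟨rfl, Prod.ext h.1 h.2⟩
  · simp only [Face.side, MidEdge.slant.injEq] at h; simp only at hf; omega

namespace YBWalk

variable {T L : ℕ}

/-- A walk between distinct edges has an arc. [folklore] -/
theorem arcs_length_pos {D : Set Face} {a z : MidEdge} (γ : YBWalk D a z) (h : a ≠ z) : 0 < γ.arcs.length := by
  by_contra h0
  have hl := γ.length_arcs
  have h1 := γ.getElem_zero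
  have h2 := γ.getElem_length_sub_one
  have e : γ.mids.length - 1 = 0 := by omega
  simp only [e] at h2
  exact h (h1.symm.trans h2)

/-- **Walks to the left boundary wind by `±π`** in the right-angle drawing. [folklore] -/
theorem winding_pi_div_two_alpha {j : ℤ} (hj : j ≠ 0) (γ : YBWalk (rect T L) origin (.vert 0 j)) :
    γ.winding (fun _ => π / 2) = π ∨ γ.winding (fun _ => π / 2) = -π := by
  have hn : 0 < γ.arcs.length := γ.arcs_length_pos (by simp [origin]; exact Ne.symm hj)
  have hW : γ.sOut (γ.arcs.length - 1) = .W :=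
    side_eq_W_of_vert_zero (side_sOut_last hn) (fc_mem (show γ.arcs.length - 1 < γ.arcs.length by omega)).1
  have key := winding_pi_div_two_eq hn (c₂ := -I) (neg_ne_zero.2 Complex.I_ne_zero) ?_
  · rw [hW] at key
    have eD : toC (midPt (MidEdge.vert 0 j)) - toC (midPt origin) = ((4 * j : ℝ) : ℂ) * I := by
      simp [toC, midPt, origin]; ring
    rw [eD] at key
    have e1 : -I * -toC (Side.nIn .W) = I := by simp [toC, Side.nIn]
    have e2 : -I * (((4 * j : ℝ) : ℂ) * I) = ((4 * j : ℝ) : ℂ) := by ring_nf; rw [Complex.I_sq]; ring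
    have e3 : I * (((4 * j : ℝ) : ℂ) * I) = ((-(4 * j) : ℝ) : ℂ) := by push_cast; ring_nf; rw [Complex.I_sq]; ring
    rw [e1, e2, e3] at key
    rcases lt_or_gt_of_ne hj with h | h
    · right
      have hr : (4 * j : ℝ) < 0 := by
        have : (j : ℝ) < 0 := by exact_mod_cast h
        linarith
      rw [key, Complex.arg_ofReal_of_neg hr, Complex.arg_ofReal_of_nonneg (by linarith)]
      ring
    · left
      have hr : (0 : ℝ) < 4 * j := by
        have : (0 : ℝ) < j := by exact_mod_cast h
        linarith
      rw [key, Complex.arg_ofReal_of_nonneg hr.le, Complex.arg_ofReal_of_neg (by linarith)]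
      ring
  · intro i hi
    rw [cvtx, cvtx, vtx_last, ← toC_sub, Complex.mul_im]
    simp only [Complex.neg_re, Complex.I_re, neg_zero, zero_mul, Complex.neg_im, Complex.I_im, toC_re, Prod.fst_sub,
      zero_add]
    have h0 : (midPt (MidEdge.vert 0 j)).1 = 0 := by simp [midPt]
    rw [h0]
    have : (0 : ℝ) ≤ ((γ.vtx i).1 : ℝ) := by exact_mod_cast vtx_fst_nonneg hn hi
    push_cast; linarith

/-- **Walks to the right boundary do not wind** in the right-angle drawing. [folklore] -/
theorem winding_pi_div_two_beta {j : ℤ} (hT : 1 ≤ T) (γ : YBWalk (rect T L) origin (.vert T j)) :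
    γ.winding (fun _ => π / 2) = 0 := by
  have hn : 0 < γ.arcs.length := γ.arcs_length_pos (by simp [origin]; omega)
  have hE : γ.sOut (γ.arcs.length - 1) = .E :=
    side_eq_E_of_vert (side_sOut_last hn) (fc_mem (show γ.arcs.length - 1 < γ.arcs.length by omega)).2.1
  have key := winding_pi_div_two_eq hn (c₂ := I) Complex.I_ne_zero ?_
  · rw [hE] at key
    have e1 : -toC (Side.nIn .E) = 1 := by simp [toC, Side.nIn]
    rw [e1, mul_one] at key
    rw [key]; ring
  · intro i hi
    rw [cvtx, cvtx, vtx_last, ← toC_sub, Complex.mul_im]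
    simp only [Complex.I_re, zero_mul, Complex.I_im, one_mul, zero_add, toC_re, Prod.fst_sub]
    have h0 : (midPt (MidEdge.vert T j)).1 = 4 * T := by simp [midPt]
    rw [h0]
    rcases vtx_trichotomy (γ := γ) hi with h | h | h
    · rw [h]; simp [midPt, origin]
    · have : ((γ.vtx i).1 : ℝ) ≤ 4 * T - 1 := by exact_mod_cast h.2.1
      push_cast; linarith
    · rw [h, h0]; push_cast; linarith

/-- `arg (i z) = π/2 + arg z` for `Re z > 0`. [folklore] -/
theorem arg_I_mul_of_re_pos {w : ℂ} (hw : 0 < w.re) : Complex.arg (I * w) = π / 2 + Complex.arg w := by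
  have hw0 : w ≠ 0 := by rintro rfl; simp at hw
  have habs := Complex.abs_arg_lt_pi_div_two_iff.2 (Or.inl hw)
  rw [abs_lt] at habs
  rw [Complex.arg_mul Complex.I_ne_zero hw0 (by rw [Complex.arg_I]; constructor <;> linarith [Real.pi_pos]), Complex.arg_I]

/-- **Walks to the top side wind by `π/2`** in the right-angle drawing. [folklore] -/
theorem winding_pi_div_two_delta {k : ℤ} (γ : YBWalk (rect T L) origin (.slant k ((L : ℤ) + 1))) :
    γ.winding (fun _ => π / 2) = π / 2 := by
  have hn : 0 < γ.arcs.length := γ.arcs_length_pos (by simp [origin])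
  obtain ⟨hN, hf⟩ := side_eq_N_of_slant (side_sOut_last hn)
    (by have := (fc_mem (γ := γ) (show γ.arcs.length - 1 < γ.arcs.length by omega)).2.2.2; omega)
  have hk : 0 ≤ k := by
    have := (fc_mem (γ := γ) (show γ.arcs.length - 1 < γ.arcs.length by omega)).1
    rw [hf] at this; exact this
  have key := winding_pi_div_two_eq hn (c₂ := 1) one_ne_zero ?_
  · rw [hN] at key
    have e1 : -toC (Side.nIn .N) = I := by simp [toC, Side.nIn]
    set Dv := toC (midPt (MidEdge.slant k ((L : ℤ) + 1))) - toC (midPt origin) with hD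
    have hre : 0 < Dv.re := by
      simp only [hD, Complex.sub_re, toC_re, midPt, origin]; push_cast
      have : (0 : ℝ) ≤ k := by exact_mod_cast hk
      linarith
    rw [e1, one_mul, one_mul, arg_I_mul_of_re_pos hre] at key
    rw [key, Complex.arg_I]; ring
  · intro i hi
    rw [cvtx, cvtx, vtx_last, ← toC_sub, one_mul, toC_im, Prod.snd_sub]
    have h0 : (midPt (MidEdge.slant k ((L : ℤ) + 1))).2 = 4 * (L + 1) := by simp [midPt]
    rw [h0]
    rcases vtx_trichotomy (γ := γ) hi with h | h | h
    · rw [h]; simp [midPt, origin]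
      have : (0 : ℝ) ≤ L := by exact_mod_cast Nat.zero_le L
      linarith
    · have : ((γ.vtx i).2 : ℝ) ≤ 4 * L + 3 := by exact_mod_cast h.2.2.2
      push_cast; linarith
    · rw [h, h0]; push_cast; linarith

/-- **Walks to the bottom side wind by `−π/2`** in the right-angle drawing. [folklore] -/
theorem winding_pi_div_two_eps {k : ℤ} (γ : YBWalk (rect T L) origin (.slant k (-(L : ℤ)))) :
    γ.winding (fun _ => π / 2) = -(π / 2) := by
  have hn : 0 < γ.arcs.length := γ.arcs_length_pos (by simp [origin])
  obtain ⟨hS, hf⟩ := side_eq_S_of_slant (side_sOut_last hn)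
    (by have := (fc_mem (γ := γ) (show γ.arcs.length - 1 < γ.arcs.length by omega)).2.2.1; omega)
  have hk : 0 ≤ k := by
    have := (fc_mem (γ := γ) (show γ.arcs.length - 1 < γ.arcs.length by omega)).1
    rw [hf] at this; exact this
  have key := winding_pi_div_two_eq hn (c₂ := -1) (neg_ne_zero.2 one_ne_zero) ?_
  · rw [hS] at key
    have e1 : (-1 : ℂ) * -toC (Side.nIn .S) = I := by simp [toC, Side.nIn]
    set Dv := toC (midPt (MidEdge.slant k (-(L : ℤ)))) - toC (midPt origin) with hD
    have hre : 0 < Dv.re := by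
      simp only [hD, Complex.sub_re, toC_re, midPt, origin]; push_cast
      have : (0 : ℝ) ≤ k := by exact_mod_cast hk
      linarith
    have him : Dv.im < 0 := by
      simp only [hD, Complex.sub_im, toC_im, midPt, origin]; push_cast
      have : (0 : ℝ) ≤ L := by exact_mod_cast Nat.zero_le L
      linarith
    rw [e1, neg_one_mul, Complex.arg_neg_eq_arg_add_pi_of_im_neg him, arg_I_mul_of_re_pos hre] at key
    rw [key, Complex.arg_I]; ring
  · intro i hi
    rw [cvtx, cvtx, vtx_last, ← toC_sub, neg_one_mul, Complex.neg_im, toC_im, Prod.snd_sub]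
    have h0 : (midPt (MidEdge.slant k (-(L : ℤ)))).2 = -4 * L := by simp [midPt]
    rw [h0]
    rcases vtx_trichotomy (γ := γ) hi with h | h | h
    · rw [h]; simp [midPt, origin]; positivity
    · have : (-4 * L + 1 : ℝ) ≤ ((γ.vtx i).2 : ℝ) := by exact_mod_cast h.2.2.1
      push_cast; linarith
    · rw [h, h0]; push_cast; linarith

end YBWalk

/-! ### The boundary windings -/

/-- **The boundary windings** (discharge of `GlazmanManolescu2019_boundaryWinding`): the winding of a
walk of `Rect_{T,L}(Θ)` from `0` is `±π` to the left side, `0` to the right side, `θ_k` to the top side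
and `θ_k − π` to the bottom side. Proof: the winding differs from that of the right-angle tiling by
the potential `θ_k − π/2` of the final edge (`YBWalk.winding_eq_winding_pi_div_two_add`), and the
right-angle winding is the total turning of an integer polyline to which Hopf's argument applies
(`Hopf.hopf_open` with `YBWalk.subtended`), evaluated through the extreme position of the endpoints.
[cite: GlazmanManolescu2019, §2.2 (proof of Corollary 2.5) and Lemma 2.2] -/
theorem GlazmanManolescu2019_boundaryWinding_holds : GlazmanManolescu2019_boundaryWinding := by
  intro T L Θ _hΘ
  refine ⟨fun j hj γ => ?_, fun j hT γ => ?_, fun k γ => ?_, fun k γ => ?_⟩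
  all_goals have h0 : slantPot Θ origin = 0 := rfl
  · rw [γ.winding_eq_winding_pi_div_two_add Θ, h0, slantPot, add_zero, sub_zero]
    exact YBWalk.winding_pi_div_two_alpha hj γ
  · rw [γ.winding_eq_winding_pi_div_two_add Θ, h0, slantPot, add_zero, sub_zero]
    exact YBWalk.winding_pi_div_two_beta hT γ
  · rw [γ.winding_eq_winding_pi_div_two_add Θ, h0, slantPot, YBWalk.winding_pi_div_two_delta γ]
    ring
  · rw [γ.winding_eq_winding_pi_div_two_add Θ, h0, slantPot, YBWalk.winding_pi_div_two_eps γ]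
    ring

end Literature.Probability.RandomPlanarGeometry.SAW.YangBaxter
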